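import Literature.Probability.Percolation.FiveArmExponentUpperNormalForm
import Literature.Probability.Percolation.MonochromaticArmQuasiMult
import Literature.Probability.Percolation.TwoArmQuasiMult
import Literature.Probability.Percolation.FiveArmCentredBound
import Literature.Probability.Percolation.AdjFourArmLandingProofs
import Literature.Probability.Percolation.ArmQuasiMultReduction
import Literature.Probability.Percolation.FiveArmOffCentreExtensionProb
import Literature.Probability.Percolation.FlipFiveArm
import Literature.Probability.Percolation.SepArmsOnScheme
import Literature.Probability.Percolation.FiveArmInnerFlip
import Mathlib.Data.Fin.Tuple.Sort
import HarnessLib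

/-!
# Quasi-multiplicativity of the arm events (Nolin 2008, Prop. 17): the proved instances

Topic `Literature/Probability/Percolation`; family `crit-perc` (`P = P_{1/2}`). Theorems only, toward
the named fact `Literature.Probability.Percolation.Nolin2008_prop17_quasiMult`
(`FiveArmExponentFacts.lean`; P. Nolin, EJP 13 (2008), §4.5 Prop. 17 [arXiv 0711.4948: Prop. 16]:
"`P̂(A_{j,σ}(n₁,n₂)) P̂(A_{j,σ}(n₂,n₃)) ≍ P̂(A_{j,σ}(n₁,n₃))`", gluing half, at `p = 1/2`, for every
number of arms `k` and every colour sequence `κ : Fin k → Bool`):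

* `Nolin2008_prop17_quasiMult_of_const'` — **constant `κ`, every `k`** (in particular `k = 0, 1` and
  the monochromatic multi-arm events): `monochromaticArm_quasiMult_of_const`
  (`MonochromaticArmQuasiMult.lean`: RSW, Harris–FKG and Menger's theorem; no arm separation).
* `Nolin2008_prop17_quasiMult_two` — **`k = 2`, every `κ`**: the non-constant sequences `(B,W)`,
  `(W,B)` have the same order-free arm event (`armEvent_comp_equiv` along `Fin.revPerm`), whose
  quasi-multiplicativity is the tree's theorem `Nolin2008_twoArm_quasiMult_holds`
  (`TwoArmQuasiMult.lean`, from the arm-separation theorem for two arms,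
  `Nolin2008_twoArm_separation_holds`).
* `Nolin2008_prop17_quasiMult_of_sorted` — **assembly / normal form of what is left**: the named fact
  follows from its instances with `k ≥ 3` arms and a MONOTONE non-constant colour sequence (`k - 1`
  sequences for each `k`: the order-free event only sees the multiset of colours,
  `polyArmProb_comp_equiv` with Mathlib's `Tuple.sort`); `Nolin2008_prop17_quasiMult_of_threeOrMoreArms`
  is the same with all non-constant sequences. Those instances are Nolin's Prop. 17 for `j ≥ 3` and
  non-constant `σ` together with the colour-switching comparison of the cyclic arrangements (Prop. 20
  [arXiv Prop. 19]); their printed proof is the arm-separation theorem (Thm. 11 [arXiv Thm. 10]) for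
  `j` arms, which the tree has for `j = 2` only (`ArmSeparationFinalProofs.lean`; for `j = 4`,
  alternating colours, near-critical, it is the open named fact `Werner2009_fourArm_separation`).

## The five-arm upper bound (Thm. 24, five-arm item): assembly from the landed extension

Toward the companion named fact `Literature.Probability.Percolation.Nolin2008_thm24_fiveArm_upper`
(Nolin 2008, §5.2 Thm. 24, five-arm item [arXiv 0711.4948: Thm. 23 (iii), pp. 16–17]: "`1 ≥
P_{1/2}(∪_{v ∈ S_{N/2}} A_v) = Σ_v P_{1/2}(A_v) ≍ N² P_{1/2}(0 ⇝⁵ ∂S_N)`"; Kesten–Sidoravicius–Zhang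
1998, Lemma 5, (3.11)–(3.15)) this file also proves the ASSEMBLY of the printed argument from its
two analytic inputs, stated as binders (D-0026):

* `Nolin2008_thm24_fiveArm_upper_of_landedExt` — the recorded fact follows from
  (a) **the landed extension** `hext`: for every large inner radius `m`, uniformly in the centre
  `v ∈ Λ_n`, `c(m) · P_{1/2}(armEvent (B,W,B,B,W) m (4n)) ≤ P_{1/2}(arms of A_v in Λ_{8n})`, the
  event `A_v` being Nolin's landed five-arm event of the hexagon `Λ_{8n}` (`fiveArmLandingArms`,
  `FiveArmUniquenessHexagon.lean`, colours `B,W,B,B,W` on the sides `0,4,2,3,1`) — in print this is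
  the arm-separation theorem with its extension (Nolin Thm. 11 and Prop. 12 [arXiv Thm. 10, Prop. 11];
  KSZ (3.12)–(3.13), "basically the same as the proof of Lemma 4 in Kesten (1987)") followed by the
  inner extension to the neighbours of `v` (`FiveArmInnerExtension.lean`); and
  (b) **colour switching** `hsw` between the two order-free colour counts `(1,4)` and `(2,3)`
  (Nolin Prop. 20 [arXiv Prop. 19]; KSZ (3.14)–(3.15), `P{G(w,n)} = P{F(w,n)}`).
  The proof is Nolin's counting: `n² · c · π(m, 4n) ≤ Σ_{v ∈ Λ_n} P(arms of A_v) ≤ 2`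
  (`sum_real_fiveArmLandingArms_triBall_le_two`, `sq_le_card_triBall`, `FiveArmCentredBound.lean`),
  monotonicity in the outer radius (`polyArmProb_anti_holds`) between consecutive multiples of `4`,
  the identification `π_{(T,F,T,F,F)} = π_{(T,F,T,T,F)}` (colour flip at `p = 1/2` and relabelling,
  `polyArmProb_FFTTT`, `polyArmProb_comp_equiv`) and the normal form
  `Nolin2008_thm24_fiveArm_upper_of_two` (`FiveArmExponentUpperNormalForm.lean`).

* `Nolin2008_thm24_fiveArm_upper_of_separation` — **the recorded fact from its two published
  inputs**: `hext` is DISCHARGED from the arm-separation theorem for `σ = BWBBW` onto the tree's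
  well-separated event, `c · π_σ(n, N) ≤ P_{1/2}(sepArms σ n N)` (`n₀ ≤ n`, `2n ≤ N`; Nolin Thm. 11
  [arXiv Thm. 10] for `(5, σ)`, the shape used in `SepArmsQuasiMult.lean`), by
  `fiveArm_landedExt_of_sepArms_separation` (`FiveArmOffCentreExtensionProb.lean`: the extension of
  the five fenced arms in their frames to the sides of the off-centre hexagon `Λ_{8n} - v`, Nolin's
  Lemma 13 and RSW, `FiveArmOffCentreExtension.lean`; the inner extension by finite energy,
  `FiveArmInnerExtensionOff.lean`; translation by `v`); `hsw` (Prop. 20) stays a binder.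

* `fiveArm_switch_of_sepArms_separation`, `Nolin2008_thm24_fiveArm_upper_of_separations` — **`hsw`
  is DISCHARGED too**: the colour switching for five arms is PROVED (`FlipFiveArm.lean`: Nolin's
  Prop. 20 "condition on any set of consecutive arms, then flip the remaining region", by a double
  exploration, `FiveArmFlip.real_sepArms_oneFour_le_polyArmProb`) from the arm-separation theorem for
  `σ₁ = BWWWW` onto `sepArms σ₁`; so the recorded fact follows from Nolin's Thm. 11 for five arms
  onto the tree's `sepArms`, for the two colour vectors `BWBBW` and `BWWWW`, and nothing else;
  `Nolin2008_thm24_fiveArm_upper_of_sepArms_separation_all` (from the uniform separation hypothesis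
  of `Nolin2008_prop17_quasiMult_of_sepArms_separation`) and
  `Nolin2008_thm24_fiveArm_upper_of_surgeries` (from the two five-arm surgeries of Nolin's induction,
  through `sepArmsOn_separation_of_surgeries`, `SepArmsOnScheme.lean`) name the exact remaining inputs.

* **`Nolin2008_thm24_fiveArm_upper_holds` — the recorded fact is DISCHARGED** (last section of
  this file) along a separation-free line: Werner's counting argument with PAINTED fat cores
  (`FiveArmPlainArms.lean`, `FiveArmCoreGadget.lean`, `FiveArmKissingTheta.lean`,
  `FiveArmKissingCount.lean`, `FiveArmEUpper.lean`: plain arms from a landing tuple of `∂Λ_m` in the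
  cyclic arrangement `B W B W W` have probability `≤ C(m)/n²`), Nolin's inner colour switching
  (§5.1 Prop. 20 [arXiv Prop. 19]) for the arrangements `B W W W B` and `B W W W W`
  (`FiveArmInnerWalk.lean`, `FiveArmInnerFlip.lean`, and `real_plainArms_B4W_le` below), the
  classification of the landing tuples (`exists_real_plainArms_le`: `Tuple.sort` and a rotation) and
  the normal form `Nolin2008_thm24_fiveArm_upper_of_two` (`fiveArm_oneFour`, `fiveArm_twoThree`).

Back to Prop. 17 (quasi-multiplicativity), further proved instances and the residual list:

* `Nolin2008_prop17_quasiMult_TFTF`, `Nolin2008_prop17_quasiMult_FFTT` — **`k = 4`, two open and two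
  closed arms** (both cyclic arrangements at once, the event being order-free): the critical
  order-free four-arm separation `critFourArm_separation_half` (`AdjFourArmLandingProofs.lean`:
  Nolin's Thm. 11 for `σ = BWBW`, `altSeparation_display`, and for `σ = BBWW`, external half,
  `Nolin2008_adjFourArm_landing_holds`, joined by the colour exchange `fourArm_flip`, Prop. 20) and
  the gluing `critFourArmProb_quasiMult_spaced_of_separation`, then the bounded-ratio normal form
  `polyArmProb_quasiMult_of_spaced_any` (`ArmQuasiMultReduction.lean`).
* `exists_eq_step_of_monotone`, `polyArmProb_step_eq_step_sub` — a monotone colour sequence is a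
  step `i ↦ (t ≤ i)`, and the steps `t` and `k - t` have the same order-free probability (colour
  duality `polyArmProb_not` and the reversal `Fin.revPerm`); whence the sharper normal form
  `Nolin2008_prop17_quasiMult_of_steps` (steps with `k ≤ 2t ≤ 2k - 2`, `(k, t) ≠ (4, 2)`) and the
  explicit residual list `Nolin2008_prop17_quasiMult_of_residual`: the named fact follows from its
  seven instances `FFT`, `FFFT`, `FFFTT`, `FFFFT`, `FFFTTT`, `FFFFTT`, `FFFFFT` (`3 ≤ k ≤ 6`: Nolin's
  Thm. 11 for these patterns onto the tree's `sepArms κ`, cf. `polyArmProb_quasiMult_of_sepArms_separation`)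
  together with the steps for `k ≥ 7` (finer landing sequences than the six sides).
## References

* P. Nolin, Near-critical percolation in two dimensions, *Electron. J. Probab.* 13 (2008) 1562–1623,
  §4.5 Prop. 17, §4.3 Thm. 11, Prop. 12, §5.1 Prop. 20, §5.2 Thm. 24 [arXiv 0711.4948: Prop. 16, Thm. 10,
  Prop. 11, Prop. 19, Thm. 23] [Nolin2008].
* H. Kesten, V. Sidoravicius, Y. Zhang, Almost all words are seen in critical site percolation on the
  triangular lattice, *Electron. J. Probab.* 3 (1998), paper 10, Lemma 5, (3.7)–(3.15)
  [KestenSidoraviciusZhang1998].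
* H. Kesten, Scaling relations for 2D-percolation, *Comm. Math. Phys.* 109 (1987) 109–156 [Kesten1987].
* W. Werner, *Lectures on two-dimensional critical percolation*, IAS/Park City Math. Ser. 16 (2009),
  §3 and First exercise sheet, "Five-arm exponent" (arXiv 0710.0856) [WernerPCMI2009].
-/

noncomputable section

namespace Literature.Probability.Percolation

open LatticeModels

/-- **Prop. 17 for constant colour sequences** (every `k`): the instance of
`Nolin2008_prop17_quasiMult` at a constant `κ : Fin k → Bool` holds
(`monochromaticArm_quasiMult_of_const`). [cite: Nolin2008, §4.5 Prop. 17 (arXiv 0711.4948: Prop. 16, p. 13), σ constant] -/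
theorem Nolin2008_prop17_quasiMult_of_const' {k : ℕ} (κ : Fin k → Bool) (hκ : ∀ i j, κ i = κ j) :
    ∃ c : ℝ, 0 < c ∧ ∃ n₀ : ℕ, ∀ n₁ n₂ n₃ : ℕ, n₀ ≤ n₁ → n₁ < n₂ → n₂ < n₃ →
      c * (polyArmProb κ n₁ n₂ * polyArmProb κ n₂ n₃) ≤ polyArmProb κ n₁ n₃ := by
  obtain ⟨c, hc, n₀, h⟩ := monochromaticArm_quasiMult_of_const κ hκ
  exact ⟨c, hc, n₀, h⟩

/-- The order-free two-arm probabilities of the colour sequences `(W,B)` and `(B,W)` coincide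
(relabelling along `Fin.revPerm`, `polyArmProb_comp_equiv`). [cite: Nolin2008, §4.1 (arXiv 0711.4948: p. 8, "we identify two sequences if they are the same up to a cyclic permutation")] -/
theorem polyArmProb_false_true_eq (r R : ℕ) : polyArmProb ![false, true] r R = critTwoArmProb r R := by
  have e : ((![true, false] : Fin 2 → Bool) ∘ Fin.revPerm) = ![false, true] := by decide
  rw [← e, critTwoArmProb]
  exact polyArmProb_comp_equiv _ _ r R

/-- **Prop. 17 for two arms, every colour sequence**: the instance of `Nolin2008_prop17_quasiMult` at
any `κ : Fin 2 → Bool` holds — constant `κ` by `Nolin2008_prop17_quasiMult_of_const'`, and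
`κ = (B,W)`, `(W,B)` by the tree's theorem `Nolin2008_twoArm_quasiMult_holds` (arm separation for two
arms). [cite: Nolin2008, §4.5 Prop. 17 (arXiv 0711.4948: Prop. 16, p. 13), j = 2] -/
theorem Nolin2008_prop17_quasiMult_two (κ : Fin 2 → Bool) :
    ∃ c : ℝ, 0 < c ∧ ∃ n₀ : ℕ, ∀ n₁ n₂ n₃ : ℕ, n₀ ≤ n₁ → n₁ < n₂ → n₂ < n₃ →
      c * (polyArmProb κ n₁ n₂ * polyArmProb κ n₂ n₃) ≤ polyArmProb κ n₁ n₃ := by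
  by_cases hκ : ∀ i j, κ i = κ j
  · exact Nolin2008_prop17_quasiMult_of_const' κ hκ
  · -- `κ` takes both values: `κ = (B,W)` or `κ = (W,B)`
    have hTF : ∀ n N : ℕ, polyArmProb κ n N = critTwoArmProb n N := by
      intro n N
      have h01 : κ 0 ≠ κ 1 := by
        intro h
        refine hκ fun i j => ?_
        have : ∀ i : Fin 2, κ i = κ 0 := fun i => by fin_cases i <;> [rfl; exact h.symm]
        rw [this i, this j]
      have hκ' : κ = ![κ 0, κ 1] := by funext i; fin_cases i <;> rfl
      rw [hκ']
      cases h0 : κ 0 <;> cases h1 : κ 1 <;> simp only [h0, h1, ne_eq, not_true_eq_false] at h01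
      · exact polyArmProb_false_true_eq n N
      · rfl
    obtain ⟨c, hc, n₀, h⟩ := Nolin2008_twoArm_quasiMult_holds
    refine ⟨c, hc, n₀, fun n₁ n₂ n₃ hn h12 h23 => ?_⟩
    rw [hTF, hTF, hTF]
    exact h n₁ n₂ n₃ hn h12 h23

/-- **Assembly, normal form.** The named fact `Nolin2008_prop17_quasiMult` (every `k`, every `κ`)
follows from its instances with at least three arms and a MONOTONE (for `false < true`) non-constant
colour sequence: the order-free arm probability is unchanged by relabelling the arms
(`polyArmProb_comp_equiv`), so `κ` may be sorted (`Tuple.sort`, `Tuple.monotone_sort`); constant `κ`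
(any `k`) is `Nolin2008_prop17_quasiMult_of_const'`, and non-constant `κ` forces `k ≥ 2`, the case
`k = 2` being `Nolin2008_prop17_quasiMult_two`. The hypothesis — `k - 1` colour sequences for each
`k ≥ 3` — is Nolin's Prop. 17 for `j ≥ 3`, non-constant `σ`, with Prop. 20 (order-free events),
whose printed proof is the arm-separation theorem (Thm. 11) for `j` arms, in the tree for `j = 2`
only. [cite: Nolin2008, §4.5 Prop. 17 with §4.3 Thm. 11 and §5.1 Prop. 20 (arXiv 0711.4948: Prop. 16, Thm. 10, Prop. 19)] -/
theorem Nolin2008_prop17_quasiMult_of_sorted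
    (h : ∀ {k : ℕ} (κ : Fin k → Bool), 3 ≤ k → Monotone κ → (∃ i j, κ i ≠ κ j) →
      ∃ c : ℝ, 0 < c ∧ ∃ n₀ : ℕ, ∀ n₁ n₂ n₃ : ℕ, n₀ ≤ n₁ → n₁ < n₂ → n₂ < n₃ →
        c * (polyArmProb κ n₁ n₂ * polyArmProb κ n₂ n₃) ≤ polyArmProb κ n₁ n₃) :
    Nolin2008_prop17_quasiMult := by
  intro k κ
  by_cases hκ : ∀ i j, κ i = κ j
  · exact Nolin2008_prop17_quasiMult_of_const' κ hκ
  · push Not at hκ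
    obtain ⟨i, j, hij⟩ := hκ
    have hk2 : 2 ≤ k := by
      have hij' : i ≠ j := fun e => hij (e ▸ rfl)
      have := Fintype.card_le_of_injective (fun b : Bool => if b then i else j) (by
        intro b b' hbb'
        cases b <;> cases b' <;> simp_all)
      simpa using this
    rcases Nat.lt_or_ge k 3 with hk | hk
    · obtain rfl : k = 2 := by omega
      exact Nolin2008_prop17_quasiMult_two κ
    · -- sort the colours
      set σ : Equiv.Perm (Fin k) := Tuple.sort κ with hσ
      have hne : ∃ a b, (κ ∘ σ) a ≠ (κ ∘ σ) b :=
        ⟨σ.symm i, σ.symm j, by simpa only [Function.comp_apply, Equiv.apply_symm_apply] using hij⟩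
      obtain ⟨c, hc, n₀, hq⟩ := h (κ ∘ σ) hk (Tuple.monotone_sort κ) hne
      refine ⟨c, hc, n₀, fun n₁ n₂ n₃ hn h12 h23 => ?_⟩
      have e : ∀ r R : ℕ, polyArmProb κ r R = polyArmProb (κ ∘ σ) r R :=
        fun r R => (polyArmProb_comp_equiv κ σ r R).symm
      rw [e, e, e]
      exact hq n₁ n₂ n₃ hn h12 h23

/-- **Assembly.** The same with the instances for all non-constant colour sequences with at least
three arms. [cite: Nolin2008, §4.5 Prop. 17 with §4.3 Thm. 11 and §5.1 Prop. 20 (arXiv 0711.4948: Prop. 16, Thm. 10, Prop. 19)] -/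
theorem Nolin2008_prop17_quasiMult_of_threeOrMoreArms
    (h : ∀ {k : ℕ} (κ : Fin k → Bool), 3 ≤ k → (∃ i j, κ i ≠ κ j) →
      ∃ c : ℝ, 0 < c ∧ ∃ n₀ : ℕ, ∀ n₁ n₂ n₃ : ℕ, n₀ ≤ n₁ → n₁ < n₂ → n₂ < n₃ →
        c * (polyArmProb κ n₁ n₂ * polyArmProb κ n₂ n₃) ≤ polyArmProb κ n₁ n₃) :
    Nolin2008_prop17_quasiMult :=
  Nolin2008_prop17_quasiMult_of_sorted fun κ hk _ hne => h κ hk hne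


/-! ### The five-arm upper bound from the landed extension and colour switching -/

/-- The colour vector `(T,F,T,T,F)` of the landed event (`nolinFive`), relabelled, is the sorted
vector `(F,F,T,T,T)`. [folklore] -/
theorem vec_TFTTF_comp_swap :
    ((![true, false, true, true, false] : Fin 5 → Bool) ∘
        ((Equiv.swap (1 : Fin 5) 4).trans (Equiv.swap (0 : Fin 5) 1))) =
      ![false, false, true, true, true] := by
  decide

/-- `P_{1/2}(armEvent (T,F,T,F,F)) = P_{1/2}(armEvent (T,F,T,T,F))`: the order-free arm event only
sees the multiset of colours, and at `p = 1/2` a global colour flip does not change its probability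
(`polyArmProb_FFTTT`). [cite: Nolin2008, §2.1 and §4.1 (arXiv 0711.4948: colour sequences up to relabelling; symmetry at p = 1/2)] -/
theorem polyArmProb_TFTFF_eq_TFTTF (r R : ℕ) :
    polyArmProb ![true, false, true, false, false] r R = polyArmProb ![true, false, true, true, false] r R := by
  rw [← polyArmProb_FFTTT, ← vec_TFTTF_comp_swap, polyArmProb_comp_equiv]

/-- **Nolin's counting at one scale.** If `c · u ≤ P_{1/2}(arms of A_v in Λ_{8n})` for every centre
`v ∈ Λ_n` (`n ≥ 1`, `c > 0`), then `u ≤ 2 / (c n²)`: sum over `v ∈ Λ_n`, use `|Λ_n| ≥ n²`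
(`sq_le_card_triBall`) and `Σ_v P_{1/2}(arms of A_v) ≤ 2` (`sum_real_fiveArmLandingArms_triBall_le_two`,
uniqueness of the landed five-arm site). [cite: Nolin2008, §5.2, proof of Thm. 24 (arXiv 0711.4948: pp. 16–17, "1 ≥ Σ_v P(A_v) ≍ N² P(0 ⇝⁵ ∂S_N)")] [cite: KestenSidoraviciusZhang1998, proof of Lemma 5, (3.11)–(3.13)] -/
theorem le_two_div_of_landed_lower {u c : ℝ} (hc : 0 < c) {n : ℕ} (hn : 1 ≤ n)
    (h : ∀ v ∈ triBall n, c * u ≤ (triSitePercolation half).real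
        (fiveArmLandingArms ↑(triBall (8 * n)) (hexSides (8 * n)) v)) :
    u ≤ 2 / (c * (n : ℝ) ^ 2) := by
  have hsum := sum_real_fiveArmLandingArms_triBall_le_two (8 * n) (triBall n)
  have hcard : ((n : ℝ)) ^ 2 ≤ (triBall n).card := by exact_mod_cast sq_le_card_triBall n
  have hlow : ((triBall n).card : ℝ) * (c * u) ≤
      ∑ v ∈ triBall n, (triSitePercolation half).real
        (fiveArmLandingArms ↑(triBall (8 * n)) (hexSides (8 * n)) v) := by
    rw [← nsmul_eq_mul, ← Finset.sum_const]
    exact Finset.sum_le_sum fun v hv => h v hv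
  have hn2 : (0 : ℝ) < (n : ℝ) ^ 2 := by positivity
  have key : (n : ℝ) ^ 2 * (c * u) ≤ 2 := by
    by_cases hU : 0 ≤ c * u
    · exact ((mul_le_mul_of_nonneg_right hcard hU).trans hlow).trans hsum
    · rw [not_le] at hU
      exact (mul_neg_of_pos_of_neg hn2 hU).le.trans (by norm_num)
  rw [le_div_iff₀ (mul_pos hc hn2)]
  calc u * (c * (n : ℝ) ^ 2) = (n : ℝ) ^ 2 * (c * u) := by ring
    _ ≤ 2 := key

/-- **The `(2,3)` clause from the landed extension.** If for every inner radius `m ≥ m₀`,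
uniformly in the centre `v ∈ Λ_n` (`n ≥ n₀(m)`), `c(m) · P_{1/2}(armEvent (T,F,T,T,F) m (4n))` is a
lower bound of the probability of the arms of Nolin's landed event `A_v` in the hexagon `Λ_{8n}`,
then `P_{1/2}(armEvent (T,F,T,F,F) m N) ≤ C(m)/N²` for all `N ≥ m`, `m ≥ m₀ ∨ 1`: counting at the
scale `n = ⌊N/4⌋` (`le_two_div_of_landed_lower`), monotonicity of the arm event in the outer radius
(`polyArmProb_anti_holds`: `π(m, N) ≤ π(m, 4n)`), `N < 8n`, and the finitely many `N < 4 max(n₀, m)`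
absorbed in the constant. [cite: Nolin2008, §5.2, proof of Thm. 24, five-arm item (arXiv 0711.4948: Thm. 23 (iii), pp. 16–17)] [cite: KestenSidoraviciusZhang1998, Lemma 5, (3.11)–(3.13)] -/
theorem fiveArm_pointUpper_TFTFF_of_landedExt
    (hext : ∃ m₀ : ℕ, ∀ m : ℕ, m₀ ≤ m → ∃ c : ℝ, 0 < c ∧ ∃ n₀ : ℕ, ∀ n : ℕ, n₀ ≤ n →
      ∀ v ∈ triBall n, c * polyArmProb ![true, false, true, true, false] m (4 * n) ≤
        (triSitePercolation half).real (fiveArmLandingArms ↑(triBall (8 * n)) (hexSides (8 * n)) v)) :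
    ∃ m₀ : ℕ, ∀ m : ℕ, m₀ ≤ m → ∃ C : ℝ, ∀ N : ℕ, m ≤ N →
      polyArmProb ![true, false, true, false, false] m N ≤ C / (N : ℝ) ^ 2 := by
  obtain ⟨m₀, hm₀⟩ := hext
  refine ⟨max m₀ 1, fun m hm => ?_⟩
  have hm1 : 1 ≤ m := le_of_max_le_right hm
  obtain ⟨c, hc, n₀, hn₀⟩ := hm₀ m (le_of_max_le_left hm)
  -- threshold: below `N₁` the bound is trivial, above it we count at scale `⌊N/4⌋`
  set N₁ : ℕ := 4 * (max n₀ m + 1) with hN₁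
  refine ⟨max (128 / c) ((N₁ : ℝ) ^ 2), fun N hmN => ?_⟩
  have hN0 : (0 : ℝ) < (N : ℝ) ^ 2 := by
    have : (1 : ℝ) ≤ N := by exact_mod_cast hm1.trans hmN
    positivity
  by_cases hN : N < N₁
  · -- small `N`
    calc polyArmProb ![true, false, true, false, false] m N ≤ 1 := polyArmProb_le_one _ _ _
      _ ≤ (N₁ : ℝ) ^ 2 / (N : ℝ) ^ 2 := by
          rw [le_div_iff₀ hN0, one_mul]
          have : (N : ℝ) ≤ N₁ := by exact_mod_cast hN.le
          nlinarith
      _ ≤ max (128 / c) ((N₁ : ℝ) ^ 2) / (N : ℝ) ^ 2 :=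
          div_le_div_of_nonneg_right (le_max_right _ _) hN0.le
  · -- large `N`: `n = ⌊N/4⌋`
    rw [not_lt] at hN
    set n : ℕ := N / 4 with hn
    have h4n : 4 * n ≤ N := Nat.mul_div_le N 4
    have hN4 : N < 4 * n + 4 := by omega
    have hn₀n : n₀ ≤ n := by omega
    have hmn : m ≤ n := by omega
    have hn1 : 1 ≤ n := hm1.trans hmn
    have hcount := le_two_div_of_landed_lower hc hn1 (hn₀ n hn₀n)
    -- `π(m, N) ≤ π(m, 4n) = π_{(T,F,T,T,F)}(m, 4n) ≤ 2/(c n²) ≤ 128/(c N²)`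
    have hanti : polyArmProb ![true, false, true, false, false] m N ≤
        polyArmProb ![true, false, true, false, false] m (4 * n) :=
      polyArmProb_anti_holds _ (by omega) h4n
    have hnr : (0 : ℝ) < (n : ℝ) ^ 2 := by positivity
    have hNn : (N : ℝ) ^ 2 ≤ 64 * (n : ℝ) ^ 2 := by
      have : (N : ℝ) ≤ 8 * n := by
        have h' : N ≤ 8 * n := by omega
        exact_mod_cast h'
      nlinarith
    calc polyArmProb ![true, false, true, false, false] m N
        ≤ polyArmProb ![true, false, true, true, false] m (4 * n) := by
          rw [← polyArmProb_TFTFF_eq_TFTTF]; exact hanti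
      _ ≤ 2 / (c * (n : ℝ) ^ 2) := hcount
      _ ≤ 128 / c / (N : ℝ) ^ 2 := by
          rw [div_div, div_le_div_iff₀ (mul_pos hc hnr) (mul_pos hc hN0)]
          nlinarith [hc]
      _ ≤ max (128 / c) ((N₁ : ℝ) ^ 2) / (N : ℝ) ^ 2 :=
          div_le_div_of_nonneg_right (le_max_left _ _) hN0.le

/-- **The `(1,4)` clause from the `(2,3)` clause and colour switching** between the two order-free
colour counts (Nolin Prop. 20 [arXiv Prop. 19]; KSZ (3.15): `P{G(w,n)} = P{F(w,n)}`): if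
`c · π_{(T,F,F,F,F)}(n, N) ≤ π_{(T,F,T,F,F)}(n, N)` for `n₀ ≤ n ≤ N`, the bound `C(m)/N²` passes from
`(T,F,T,F,F)` to `(T,F,F,F,F)` for `m ≥ n₀`. [cite: Nolin2008, §5.1 Prop. 20 and §5.2 Thm. 24 (arXiv 0711.4948: Prop. 19, Thm. 23 (iii))] [cite: KestenSidoraviciusZhang1998, Lemma 5, (3.14)–(3.15)] -/
theorem fiveArm_pointUpper_TFFFF_of_switch
    (hsw : ∃ c : ℝ, 0 < c ∧ ∃ n₀ : ℕ, ∀ n N : ℕ, n₀ ≤ n → n ≤ N →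
      c * polyArmProb ![true, false, false, false, false] n N ≤ polyArmProb ![true, false, true, false, false] n N)
    (h₂ : ∃ m₀ : ℕ, ∀ m : ℕ, m₀ ≤ m → ∃ C : ℝ, ∀ N : ℕ, m ≤ N →
      polyArmProb ![true, false, true, false, false] m N ≤ C / (N : ℝ) ^ 2) :
    ∃ m₀ : ℕ, ∀ m : ℕ, m₀ ≤ m → ∃ C : ℝ, ∀ N : ℕ, m ≤ N →
      polyArmProb ![true, false, false, false, false] m N ≤ C / (N : ℝ) ^ 2 := by
  obtain ⟨c, hc, n₀, hn₀⟩ := hsw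
  obtain ⟨m₀, hm₀⟩ := h₂
  refine ⟨max m₀ n₀, fun m hm => ?_⟩
  obtain ⟨C, hC⟩ := hm₀ m (le_of_max_le_left hm)
  refine ⟨C / c, fun N hmN => ?_⟩
  have hsw' := hn₀ m N (le_of_max_le_right hm) hmN
  have hN0 : (0 : ℝ) ≤ (N : ℝ) ^ 2 := by positivity
  calc polyArmProb ![true, false, false, false, false] m N
      ≤ polyArmProb ![true, false, true, false, false] m N / c := by
        rw [le_div_iff₀ hc, mul_comm]; exact hsw'
    _ ≤ C / (N : ℝ) ^ 2 / c := div_le_div_of_nonneg_right (hC N hmN) hc.le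
    _ = C / c / (N : ℝ) ^ 2 := by rw [div_right_comm]

/-- **Nolin's Thm. 24, five-arm item, from its two analytic inputs.** The recorded fact
`Nolin2008_thm24_fiveArm_upper` (for every non-constant `κ : Fin 5 → Bool` and `m ≥ 1`,
`P_{1/2}(armEvent κ m N) ≤ C/N²`) follows from
(a) the LANDED EXTENSION `hext` — uniformly in `v ∈ Λ_n`, the arms of Nolin's landed event `A_v` in
the hexagon `Λ_{8n}` (`fiveArmLandingArms`, colours `B,W,B,B,W` landing on the sides `0,4,2,3,1`)
have probability at least `c(m) · P_{1/2}(armEvent (T,F,T,T,F) m (4n))` for all large inner radii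
`m` — in print the arm-separation theorem and the extension of separated arms (Nolin Thm. 11,
Prop. 12 [arXiv Thm. 10, Prop. 11]; KSZ (3.12)–(3.13)) followed by the inner extension of
`FiveArmInnerExtension.lean` — and (b) COLOUR SWITCHING `hsw` between the colour counts `(1,4)` and
`(2,3)` (Nolin Prop. 20 [arXiv Prop. 19]; KSZ (3.14)–(3.15)); by Nolin's counting
(`fiveArm_pointUpper_TFTFF_of_landedExt`), `fiveArm_pointUpper_TFFFF_of_switch` and the normal form
`Nolin2008_thm24_fiveArm_upper_of_two`. Neither hypothesis is a form of the conclusion: (a) compares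
two events at the same scale, (b) two colour counts; the decay `N⁻²` is produced here. [cite: Nolin2008, §5.2 Thm. 24, five-arm item, proof pp. 16–17 (arXiv 0711.4948: Thm. 23 (iii))] [cite: KestenSidoraviciusZhang1998, Lemma 5, (3.7), (3.11)–(3.15)] -/
theorem Nolin2008_thm24_fiveArm_upper_of_landedExt
    (hext : ∃ m₀ : ℕ, ∀ m : ℕ, m₀ ≤ m → ∃ c : ℝ, 0 < c ∧ ∃ n₀ : ℕ, ∀ n : ℕ, n₀ ≤ n →
      ∀ v ∈ triBall n, c * polyArmProb ![true, false, true, true, false] m (4 * n) ≤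
        (triSitePercolation half).real (fiveArmLandingArms ↑(triBall (8 * n)) (hexSides (8 * n)) v))
    (hsw : ∃ c : ℝ, 0 < c ∧ ∃ n₀ : ℕ, ∀ n N : ℕ, n₀ ≤ n → n ≤ N →
      c * polyArmProb ![true, false, false, false, false] n N ≤ polyArmProb ![true, false, true, false, false] n N) :
    Nolin2008_thm24_fiveArm_upper :=
  have h₂ := fiveArm_pointUpper_TFTFF_of_landedExt hext
  Nolin2008_thm24_fiveArm_upper_of_two (fiveArm_pointUpper_TFFFF_of_switch hsw h₂) h₂

/-! ### Four arms, two of each colour -/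

/-- **Prop. 17 for `κ = (B,W,B,W)`, order-free** (`π₄ = critFourArmProb`): quasi-multiplicativity
of the tree's order-free four-arm probability at `p = 1/2`, from the critical order-free
separation onto `sepFourArm` (`critFourArm_separation_half`: Thm. 11 for `BWBW` and, through the
colour-exchange flip of Prop. 20, the external half of Thm. 11 for `BBWW`), the gluing
(`critFourArmProb_quasiMult_spaced`) and the bounded-ratio normal form
(`polyArmProb_quasiMult_of_spaced_any`). [cite: Nolin2008, §4.5 Prop. 17, j = 4, with §4.3 Thm. 11 and §5.1 Prop. 20 (arXiv 0711.4948: Prop. 16, Thm. 10, Prop. 19)] -/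
theorem Nolin2008_prop17_quasiMult_TFTF :
    ∃ c : ℝ, 0 < c ∧ ∃ n₀ : ℕ, ∀ n₁ n₂ n₃ : ℕ, n₀ ≤ n₁ → n₁ < n₂ → n₂ < n₃ →
      c * (polyArmProb ![true, false, true, false] n₁ n₂ * polyArmProb ![true, false, true, false] n₂ n₃) ≤
        polyArmProb ![true, false, true, false] n₁ n₃ :=
  polyArmProb_quasiMult_of_spaced_any _ (A := 2048) (by norm_num) critFourArmProb_quasiMult_spaced

/-- **Prop. 17 for the sorted sequence `κ = (W,W,B,B)`** (the same order-free event, relabelled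
along `Equiv.swap 0 3`, `polyArmProb_comp_equiv`). [cite: Nolin2008, §4.5 Prop. 17, j = 4 (arXiv 0711.4948: Prop. 16)] -/
theorem Nolin2008_prop17_quasiMult_FFTT :
    ∃ c : ℝ, 0 < c ∧ ∃ n₀ : ℕ, ∀ n₁ n₂ n₃ : ℕ, n₀ ≤ n₁ → n₁ < n₂ → n₂ < n₃ →
      c * (polyArmProb ![false, false, true, true] n₁ n₂ * polyArmProb ![false, false, true, true] n₂ n₃) ≤
        polyArmProb ![false, false, true, true] n₁ n₃ := by
  have e : ((![true, false, true, false] : Fin 4 → Bool) ∘ Equiv.swap (0 : Fin 4) 3) =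
      ![false, false, true, true] := by decide
  have hπ : ∀ r R : ℕ, polyArmProb ![false, false, true, true] r R = polyArmProb ![true, false, true, false] r R := by
    intro r R; rw [← e]; exact polyArmProb_comp_equiv _ _ r R
  obtain ⟨c, hc, n₀, h⟩ := Nolin2008_prop17_quasiMult_TFTF
  refine ⟨c, hc, n₀, fun n₁ n₂ n₃ hn h12 h23 => ?_⟩
  rw [hπ, hπ, hπ]
  exact h n₁ n₂ n₃ hn h12 h23

/-! ### Monotone colour sequences are steps; the sharper normal form -/

/-- **A monotone Boolean sequence on `Fin k` is a step**: `κ i = (t ≤ i)` with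
`t = #{i | κ i = false} ≤ k` (the `false`s form an initial segment). [folklore] -/
theorem exists_eq_step_of_monotone {k : ℕ} (κ : Fin k → Bool) (hκ : Monotone κ) :
    ∃ t : ℕ, t ≤ k ∧ κ = fun i : Fin k => decide (t ≤ i.val) := by
  classical
  set F : Finset (Fin k) := Finset.univ.filter fun i => κ i = false with hF
  refine ⟨F.card, (Finset.card_le_univ F).trans_eq (Fintype.card_fin k), funext fun i => ?_⟩
  by_cases hi : κ i = true
  · -- all `j ≥ i` are `true`, so `F ⊆ Iio i`
    have hsub : F ⊆ Finset.Iio i := by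
      intro j hj
      rw [hF, Finset.mem_filter] at hj
      rw [Finset.mem_Iio]
      by_contra hji
      have hle : κ i ≤ κ j := hκ (not_lt.1 hji)
      rw [hi, hj.2] at hle
      exact absurd hle (by decide)
    have hc : F.card ≤ i.val := (Finset.card_le_card hsub).trans_eq (Fin.card_Iio i)
    rw [hi]; exact (decide_eq_true hc).symm
  · -- all `j ≤ i` are `false`, so `Iic i ⊆ F`
    have hi' : κ i = false := by simpa using hi
    have hsub : Finset.Iic i ⊆ F := by
      intro j hj
      rw [Finset.mem_Iic] at hj
      rw [hF, Finset.mem_filter]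
      refine ⟨Finset.mem_univ _, ?_⟩
      have hle : κ j ≤ κ i := hκ hj
      rw [hi'] at hle
      cases h : κ j
      · rfl
      · rw [h] at hle; exact absurd hle (by decide)
    have hc : i.val + 1 ≤ F.card := (Fin.card_Iic i).symm.trans_le (Finset.card_le_card hsub)
    rw [hi']
    symm
    rw [decide_eq_false_iff_not]
    omega

/-- **The steps `t` and `k - t` have the same order-free arm probability** (`t ≤ k`): colour
duality at `p = 1/2` (`polyArmProb_not`) turns the step `t` into its complement, which is the step
`k - t` read backwards (`Fin.revPerm`, `polyArmProb_comp_equiv`). [cite: Nolin2008, §4.1 (arXiv 0711.4948: p. 8, colour sequences up to cyclic permutation; §5.1, P_{1/2} is invariant under colour exchange)] -/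
theorem polyArmProb_step_eq_step_sub {k t : ℕ} (ht : t ≤ k) (r R : ℕ) :
    polyArmProb (fun i : Fin k => decide (t ≤ i.val)) r R =
      polyArmProb (fun i : Fin k => decide (k - t ≤ i.val)) r R := by
  have e : (fun i : Fin k => !decide (t ≤ i.val)) =
      ((fun i : Fin k => decide (k - t ≤ i.val)) ∘ (Fin.revPerm : Fin k ≃ Fin k)) := by
    funext i
    simp only [Function.comp_apply, Fin.revPerm_apply, Fin.val_rev]
    have hi := i.2
    by_cases h : t ≤ i.val
    · rw [decide_eq_true h, Bool.not_true]; symm; rw [decide_eq_false_iff_not]; omega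
    · rw [decide_eq_false h, Bool.not_false]; symm; rw [decide_eq_true_eq]; omega
  rw [← polyArmProb_not (fun i : Fin k => decide (t ≤ i.val)), e]
  exact polyArmProb_comp_equiv _ _ r R

/-- **Sharper normal form.** `Nolin2008_prop17_quasiMult` follows from its instances at the steps
`κ = (i ↦ t ≤ i) : Fin k → Bool` with `k ≥ 3`, `k ≤ 2t` and `t + 1 ≤ k` (at least as many `false`
as `true`, both present), except `(k, t) = (4, 2)` which is `Nolin2008_prop17_quasiMult_FFTT`:
sort (`Nolin2008_prop17_quasiMult_of_sorted`), write the monotone sequence as a step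
(`exists_eq_step_of_monotone`), and pass to `k - t` when `2t < k` (`polyArmProb_step_eq_step_sub`). [cite: Nolin2008, §4.5 Prop. 17 with §4.3 Thm. 11 and §5.1 Prop. 20 (arXiv 0711.4948: Prop. 16, Thm. 10, Prop. 19)] -/
theorem Nolin2008_prop17_quasiMult_of_steps
    (h : ∀ k t : ℕ, 3 ≤ k → k ≤ 2 * t → t + 1 ≤ k → ¬ (k = 4 ∧ t = 2) →
      ∃ c : ℝ, 0 < c ∧ ∃ n₀ : ℕ, ∀ n₁ n₂ n₃ : ℕ, n₀ ≤ n₁ → n₁ < n₂ → n₂ < n₃ →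
        c * (polyArmProb (fun i : Fin k => decide (t ≤ i.val)) n₁ n₂ *
          polyArmProb (fun i : Fin k => decide (t ≤ i.val)) n₂ n₃) ≤
          polyArmProb (fun i : Fin k => decide (t ≤ i.val)) n₁ n₃) :
    Nolin2008_prop17_quasiMult := by
  refine Nolin2008_prop17_quasiMult_of_sorted fun {k} κ hk hmono hne => ?_
  obtain ⟨t, htk, rfl⟩ := exists_eq_step_of_monotone κ hmono
  -- both colours present: `1 ≤ t ≤ k - 1`
  obtain ⟨i, j, hij⟩ := hne
  have ht1 : 1 ≤ t := by
    by_contra h0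
    push Not at h0
    have : t = 0 := by omega
    subst this
    exact hij (by simp)
  have htk' : t + 1 ≤ k := by
    by_contra h0
    push Not at h0
    have : t = k := by omega
    subst this
    apply hij
    have hi := i.2; have hj := j.2
    show decide (t ≤ i.val) = decide (t ≤ j.val)
    rw [decide_eq_false (by omega), decide_eq_false (by omega)]
  -- the step `t` or the step `k - t`
  have main : ∀ s : ℕ, k ≤ 2 * s → s + 1 ≤ k →
      ∃ c : ℝ, 0 < c ∧ ∃ n₀ : ℕ, ∀ n₁ n₂ n₃ : ℕ, n₀ ≤ n₁ → n₁ < n₂ → n₂ < n₃ →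
        c * (polyArmProb (fun i : Fin k => decide (s ≤ i.val)) n₁ n₂ *
          polyArmProb (fun i : Fin k => decide (s ≤ i.val)) n₂ n₃) ≤
          polyArmProb (fun i : Fin k => decide (s ≤ i.val)) n₁ n₃ := by
    intro s hs1 hs2
    by_cases h42 : k = 4 ∧ s = 2
    · obtain ⟨rfl, rfl⟩ := h42
      have e : (fun i : Fin 4 => decide (2 ≤ i.val)) = ![false, false, true, true] := by decide
      rw [e]
      exact Nolin2008_prop17_quasiMult_FFTT
    · exact h k s hk hs1 hs2 h42
  by_cases hcase : k ≤ 2 * t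
  · exact main t hcase htk'
  · obtain ⟨c, hc, n₀, hq⟩ := main (k - t) (by omega) (by omega)
    refine ⟨c, hc, n₀, fun n₁ n₂ n₃ hn h12 h23 => ?_⟩
    rw [polyArmProb_step_eq_step_sub htk, polyArmProb_step_eq_step_sub htk, polyArmProb_step_eq_step_sub htk]
    exact hq n₁ n₂ n₃ hn h12 h23

/-- **The residual list.** `Nolin2008_prop17_quasiMult` follows from its seven instances at the
sorted colour sequences `FFT` (`k = 3`), `FFFT` (`k = 4`), `FFFTT`, `FFFFT` (`k = 5`), `FFFTTT`,
`FFFFTT`, `FFFFFT` (`k = 6`) — Nolin's Prop. 17 (with Prop. 20 when the colours admit several cyclic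
arrangements) for the patterns with `3 ≤ j ≤ 6` arms other than two-and-two, whose printed proof is
the arm-separation Thm. 11 for these patterns (in the tree's format: separation onto `sepArms κ`,
`polyArmProb_quasiMult_of_sepArms_separation`, `SepArmsQuasiMult.lean`) — together with the steps
for `k ≥ 7` arms (Thm. 11 with landing sequences finer than the six sides of the hexagons). [cite: Nolin2008, §4.5 Prop. 17 with §4.3 Thm. 11 and §5.1 Prop. 20 (arXiv 0711.4948: Prop. 16, Thm. 10, Prop. 19)] -/
theorem Nolin2008_prop17_quasiMult_of_residual
    (h3 : ∃ c : ℝ, 0 < c ∧ ∃ n₀ : ℕ, ∀ n₁ n₂ n₃ : ℕ, n₀ ≤ n₁ → n₁ < n₂ → n₂ < n₃ →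
      c * (polyArmProb ![false, false, true] n₁ n₂ * polyArmProb ![false, false, true] n₂ n₃) ≤
        polyArmProb ![false, false, true] n₁ n₃)
    (h4 : ∃ c : ℝ, 0 < c ∧ ∃ n₀ : ℕ, ∀ n₁ n₂ n₃ : ℕ, n₀ ≤ n₁ → n₁ < n₂ → n₂ < n₃ →
      c * (polyArmProb ![false, false, false, true] n₁ n₂ * polyArmProb ![false, false, false, true] n₂ n₃) ≤
        polyArmProb ![false, false, false, true] n₁ n₃)
    (h5a : ∃ c : ℝ, 0 < c ∧ ∃ n₀ : ℕ, ∀ n₁ n₂ n₃ : ℕ, n₀ ≤ n₁ → n₁ < n₂ → n₂ < n₃ →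
      c * (polyArmProb ![false, false, false, true, true] n₁ n₂ *
        polyArmProb ![false, false, false, true, true] n₂ n₃) ≤
        polyArmProb ![false, false, false, true, true] n₁ n₃)
    (h5b : ∃ c : ℝ, 0 < c ∧ ∃ n₀ : ℕ, ∀ n₁ n₂ n₃ : ℕ, n₀ ≤ n₁ → n₁ < n₂ → n₂ < n₃ →
      c * (polyArmProb ![false, false, false, false, true] n₁ n₂ *
        polyArmProb ![false, false, false, false, true] n₂ n₃) ≤
        polyArmProb ![false, false, false, false, true] n₁ n₃)
    (h6a : ∃ c : ℝ, 0 < c ∧ ∃ n₀ : ℕ, ∀ n₁ n₂ n₃ : ℕ, n₀ ≤ n₁ → n₁ < n₂ → n₂ < n₃ →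
      c * (polyArmProb ![false, false, false, true, true, true] n₁ n₂ *
        polyArmProb ![false, false, false, true, true, true] n₂ n₃) ≤
        polyArmProb ![false, false, false, true, true, true] n₁ n₃)
    (h6b : ∃ c : ℝ, 0 < c ∧ ∃ n₀ : ℕ, ∀ n₁ n₂ n₃ : ℕ, n₀ ≤ n₁ → n₁ < n₂ → n₂ < n₃ →
      c * (polyArmProb ![false, false, false, false, true, true] n₁ n₂ *
        polyArmProb ![false, false, false, false, true, true] n₂ n₃) ≤
        polyArmProb ![false, false, false, false, true, true] n₁ n₃)
    (h6c : ∃ c : ℝ, 0 < c ∧ ∃ n₀ : ℕ, ∀ n₁ n₂ n₃ : ℕ, n₀ ≤ n₁ → n₁ < n₂ → n₂ < n₃ →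
      c * (polyArmProb ![false, false, false, false, false, true] n₁ n₂ *
        polyArmProb ![false, false, false, false, false, true] n₂ n₃) ≤
        polyArmProb ![false, false, false, false, false, true] n₁ n₃)
    (h7 : ∀ k t : ℕ, 7 ≤ k → k ≤ 2 * t → t + 1 ≤ k →
      ∃ c : ℝ, 0 < c ∧ ∃ n₀ : ℕ, ∀ n₁ n₂ n₃ : ℕ, n₀ ≤ n₁ → n₁ < n₂ → n₂ < n₃ →
        c * (polyArmProb (fun i : Fin k => decide (t ≤ i.val)) n₁ n₂ *
          polyArmProb (fun i : Fin k => decide (t ≤ i.val)) n₂ n₃) ≤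
          polyArmProb (fun i : Fin k => decide (t ≤ i.val)) n₁ n₃) :
    Nolin2008_prop17_quasiMult := by
  refine Nolin2008_prop17_quasiMult_of_steps fun k t hk hkt htk h42 => ?_
  rcases Nat.lt_or_ge k 7 with hk7 | hk7
  · -- `3 ≤ k ≤ 6`: the seven patterns
    interval_cases k
    · obtain rfl : t = 2 := by omega
      have e : (fun i : Fin 3 => decide (2 ≤ i.val)) = ![false, false, true] := by decide
      rw [e]; exact h3
    · obtain rfl : t = 3 := by omega
      have e : (fun i : Fin 4 => decide (3 ≤ i.val)) = ![false, false, false, true] := by decide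
      rw [e]; exact h4
    · rcases (show t = 3 ∨ t = 4 by omega) with rfl | rfl
      · have e : (fun i : Fin 5 => decide (3 ≤ i.val)) = ![false, false, false, true, true] := by decide
        rw [e]; exact h5a
      · have e : (fun i : Fin 5 => decide (4 ≤ i.val)) = ![false, false, false, false, true] := by decide
        rw [e]; exact h5b
    · rcases (show t = 3 ∨ t = 4 ∨ t = 5 by omega) with rfl | rfl | rfl
      · have e : (fun i : Fin 6 => decide (3 ≤ i.val)) = ![false, false, false, true, true, true] := by decide
        rw [e]; exact h6a
      · have e : (fun i : Fin 6 => decide (4 ≤ i.val)) = ![false, false, false, false, true, true] := by decide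
        rw [e]; exact h6b
      · have e : (fun i : Fin 6 => decide (5 ≤ i.val)) = ![false, false, false, false, false, true] := by decide
        rw [e]; exact h6c
  · exact h7 k t hk7 hkt htk

/-! ### The five-arm upper bound from arm separation onto `sepArms (B,W,B,B,W)` and colour switching -/

/-- **Nolin's Thm. 24, five-arm item, from its two published inputs** (Nolin 2008, §5.2, proof of
Thm. 24 [arXiv 0711.4948: Thm. 23 (iii), pp. 16–17]; Kesten–Sidoravicius–Zhang 1998, Lemma 5): the
named fact `Nolin2008_thm24_fiveArm_upper` follows from
(a) **arm separation** for five arms of colours `σ = BWBBW` onto the well-separated event `sepArms σ`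
of `SepArmsGlue.lean` (arm `j` fenced, of colour `σ_j`, landed on the middle halves of side `j` of
both hexagons): `c · π_σ(n, N) ≤ P_{1/2}(sepArms σ n N)` for `n₀ ≤ n`, `2n ≤ N` — Nolin's Thm. 11
[arXiv Thm. 10] for `(5, σ)` (after Kesten 1987, Lemma 4; KSZ (3.12): "very similar to the proof of
Lemma 4 in Kesten (1987)"), in the shape consumed by `polyArmProb_quasiMult_of_sepArms_separation` —
through the landed extension `fiveArm_landedExt_of_sepArms_separation`
(`FiveArmOffCentreExtensionProb.lean`), and
(b) **colour switching** `hsw` between the order-free colour counts `(1,4)` and `(2,3)` (Nolin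
Prop. 20 [arXiv Prop. 19]; KSZ (3.14)–(3.15)).
Then `Nolin2008_thm24_fiveArm_upper_of_landedExt` (uniqueness and counting). [cite: Nolin2008, §5.2 Thm. 24 (five-arm item) with §4.3 Thm. 11, Prop. 12, Lemma 13 and §5.1 Prop. 20 (arXiv 0711.4948: Thm. 23 (iii), Thm. 10, Prop. 11, Lemma 12, Prop. 19)] [cite: KestenSidoraviciusZhang1998, Lemma 5, (3.10)–(3.15)] -/
theorem Nolin2008_thm24_fiveArm_upper_of_separation
    (hsep : ∃ c : ℝ, 0 < c ∧ ∃ n₀ : ℕ, ∀ n N : ℕ, n₀ ≤ n → 2 * n ≤ N →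
      c * polyArmProb ![true, false, true, true, false] n N ≤
        (triSitePercolation half).real (sepArms ![true, false, true, true, false] n N))
    (hsw : ∃ c : ℝ, 0 < c ∧ ∃ n₀ : ℕ, ∀ n N : ℕ, n₀ ≤ n → n ≤ N →
      c * polyArmProb ![true, false, false, false, false] n N ≤ polyArmProb ![true, false, true, false, false] n N) :
    Nolin2008_thm24_fiveArm_upper :=
  Nolin2008_thm24_fiveArm_upper_of_landedExt (fiveArm_landedExt_of_sepArms_separation hsep) hsw

/-! ### The whole fact from Nolin's arm-separation theorem: the exact remaining inputs

Nolin's printed proof of Prop. 17 [arXiv Prop. 16] is: arm separation (Thm. 11 [arXiv Thm. 10]) +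
extendability and gluing of well-separated arms (Prop. 12 [arXiv Prop. 11]); for the tree's
ORDER-FREE events one adds the colour exchange of Prop. 20 [arXiv Prop. 19] to funnel all cyclic
arrangements of one colour multiset into the landed arrangement.  Everything but the separation is
proved in the tree for `k ≤ 6` arms (`polyArmProb_quasiMult_of_sepArms_separation`,
`SepArmsQuasiMult.lean`; the instances `k ≤ 2`, constant `κ` and `k = 4` two-and-two need no
hypothesis at all, above).  The two theorems below record the fact as a consequence of EXACTLY
(a) Nolin's Thm. 11 with Prop. 20 at `p = 1/2` for `k ≤ 6` arms in the tree's format — separation of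
`armEvent κ n N` onto the well-separated event `sepArms κ n N` of `SepArmsGlue.lean` (arm `j` fenced,
of colour `κ j`, landed on the middle halves of side `j` of `∂Λ_n` and of `∂Λ_N`) at constant cost,
`n₀ ≤ n`, `2n ≤ N` — either uniformly in `(k, κ)`, `k ≤ 6`, or for the seven patterns that remain
after the proved instances (the `k = 5` pattern being stated for the colour vector `(T,F,T,T,F)`, the
very input `hsep` of `Nolin2008_thm24_fiveArm_upper_of_separation`), and (b) the clauses of the fact
for the step patterns with `k ≥ 7` arms, for which Thm. 11 needs landing sequences finer than the
six sides of the hexagons `Λ_N` (Nolin, §4.2 Def. 8: `j` disjoint sub-intervals of `∂S_N` of length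
`≥ η N`), a format the tree does not have yet. -/

/-- Transport of a quasi-multiplicativity clause along an identity of arm probabilities. [folklore] -/
theorem polyArmProb_quasiMult_congr {k k' : ℕ} {κ : Fin k → Bool} {κ' : Fin k' → Bool}
    (he : ∀ r R : ℕ, polyArmProb κ r R = polyArmProb κ' r R)
    (h : ∃ c : ℝ, 0 < c ∧ ∃ n₀ : ℕ, ∀ n₁ n₂ n₃ : ℕ, n₀ ≤ n₁ → n₁ < n₂ → n₂ < n₃ →
      c * (polyArmProb κ' n₁ n₂ * polyArmProb κ' n₂ n₃) ≤ polyArmProb κ' n₁ n₃) :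
    ∃ c : ℝ, 0 < c ∧ ∃ n₀ : ℕ, ∀ n₁ n₂ n₃ : ℕ, n₀ ≤ n₁ → n₁ < n₂ → n₂ < n₃ →
      c * (polyArmProb κ n₁ n₂ * polyArmProb κ n₂ n₃) ≤ polyArmProb κ n₁ n₃ := by
  obtain ⟨c, hc, n₀, h⟩ := h
  exact ⟨c, hc, n₀, fun n₁ n₂ n₃ h₁ h₂ h₃ => by simpa only [he] using h n₁ n₂ n₃ h₁ h₂ h₃⟩

/-- `P_{1/2}(armEvent (F,F,T)) = P_{1/2}(armEvent (T,T,F))` (colour flip at `p = 1/2`). [cite: SmirnovWernerMRL2001, Rem. 2] -/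
theorem polyArmProb_FFT_eq_TTF (r R : ℕ) : polyArmProb ![false, false, true] r R = polyArmProb ![true, true, false] r R := by
  have e : (fun j => !(![false, false, true] : Fin 3 → Bool) j) = ![true, true, false] := by decide
  rw [← polyArmProb_not ![false, false, true], e]

/-- `P_{1/2}(armEvent (F,F,F,T)) = P_{1/2}(armEvent (T,T,T,F))` (colour flip at `p = 1/2`). [cite: SmirnovWernerMRL2001, Rem. 2] -/
theorem polyArmProb_FFFT_eq_TTTF (r R : ℕ) :
    polyArmProb ![false, false, false, true] r R = polyArmProb ![true, true, true, false] r R := by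
  have e : (fun j => !(![false, false, false, true] : Fin 4 → Bool) j) = ![true, true, true, false] := by decide
  rw [← polyArmProb_not ![false, false, false, true], e]

/-- `P_{1/2}(armEvent (F,F,F,T,T)) = P_{1/2}(armEvent (T,F,T,T,F))` (colour flip at `p = 1/2` and
relabelling of the arms: the order-free event only sees the multiset of colours). [cite: SmirnovWernerMRL2001, Rem. 2] -/
theorem polyArmProb_FFFTT_eq_TFTTF (r R : ℕ) :
    polyArmProb ![false, false, false, true, true] r R = polyArmProb ![true, false, true, true, false] r R := by
  have e : (fun j => !(![false, false, false, true, true] : Fin 5 → Bool) j) = ![true, true, true, false, false] := by decide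
  have e' : ((![true, true, true, false, false] : Fin 5 → Bool) ∘ (Equiv.swap (1 : Fin 5) 3)) =
      ![true, false, true, true, false] := by decide
  rw [← polyArmProb_not ![false, false, false, true, true], e, ← e', polyArmProb_comp_equiv]

/-- `P_{1/2}(armEvent (F,F,F,F,T)) = P_{1/2}(armEvent (T,T,T,T,F))` (colour flip at `p = 1/2`). [cite: SmirnovWernerMRL2001, Rem. 2] -/
theorem polyArmProb_FFFFT_eq_TTTTF (r R : ℕ) :
    polyArmProb ![false, false, false, false, true] r R = polyArmProb ![true, true, true, true, false] r R := by
  have e : (fun j => !(![false, false, false, false, true] : Fin 5 → Bool) j) = ![true, true, true, true, false] := by decide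
  rw [← polyArmProb_not ![false, false, false, false, true], e]

/-- `P_{1/2}(armEvent (F,F,F,T,T,T)) = P_{1/2}(armEvent (T,F,T,F,T,F))` (colour flip and relabelling). [cite: SmirnovWernerMRL2001, Rem. 2] -/
theorem polyArmProb_FFFTTT_eq_TFTFTF (r R : ℕ) :
    polyArmProb ![false, false, false, true, true, true] r R = polyArmProb ![true, false, true, false, true, false] r R := by
  have e : (fun j => !(![false, false, false, true, true, true] : Fin 6 → Bool) j) =
      ![true, true, true, false, false, false] := by decide
  have e' : ((![true, true, true, false, false, false] : Fin 6 → Bool) ∘ (Equiv.swap (1 : Fin 6) 4)) =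
      ![true, false, true, false, true, false] := by decide
  rw [← polyArmProb_not ![false, false, false, true, true, true], e, ← e', polyArmProb_comp_equiv]

/-- `P_{1/2}(armEvent (F,F,F,F,T,T)) = P_{1/2}(armEvent (T,T,F,T,T,F))` (colour flip and relabelling). [cite: SmirnovWernerMRL2001, Rem. 2] -/
theorem polyArmProb_FFFFTT_eq_TTFTTF (r R : ℕ) :
    polyArmProb ![false, false, false, false, true, true] r R = polyArmProb ![true, true, false, true, true, false] r R := by
  have e : (fun j => !(![false, false, false, false, true, true] : Fin 6 → Bool) j) =
      ![true, true, true, true, false, false] := by decide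
  have e' : ((![true, true, true, true, false, false] : Fin 6 → Bool) ∘ (Equiv.swap (2 : Fin 6) 4)) =
      ![true, true, false, true, true, false] := by decide
  rw [← polyArmProb_not ![false, false, false, false, true, true], e, ← e', polyArmProb_comp_equiv]

/-- `P_{1/2}(armEvent (F,F,F,F,F,T)) = P_{1/2}(armEvent (T,T,T,T,T,F))` (colour flip at `p = 1/2`). [cite: SmirnovWernerMRL2001, Rem. 2] -/
theorem polyArmProb_FFFFFT_eq_TTTTTF (r R : ℕ) :
    polyArmProb ![false, false, false, false, false, true] r R =
      polyArmProb ![true, true, true, true, true, false] r R := by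
  have e : (fun j => !(![false, false, false, false, false, true] : Fin 6 → Bool) j) =
      ![true, true, true, true, true, false] := by decide
  rw [← polyArmProb_not ![false, false, false, false, false, true], e]

/-- **Nolin 2008, Prop. 17 from its printed inputs, uniform form**: the named fact
`Nolin2008_prop17_quasiMult` follows from
(a) `hsep` — Nolin's arm-separation theorem with colour exchange at `p = 1/2` for at most six arms
in the tree's format (Thm. 11 [arXiv Thm. 10] for the arrangement `κ` read on the sides `0, …, k-1`,
with Prop. 20 [arXiv Prop. 19] bounding the order-free `armEvent κ` by that arrangement): for
`k ≤ 6` and `κ : Fin k → Bool`, `c · P_{1/2}(armEvent κ n N) ≤ P_{1/2}(sepArms κ n N)` for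
`n₀ ≤ n`, `2n ≤ N` — exactly the hypothesis of `polyArmProb_quasiMult_le_six_of_separation`
(`SepArmsQuasiMult.lean`), which supplies Prop. 12 (gluing, extendability) and the reduction to
well-spaced radii — and
(b) `h7` — the clauses of the fact for the step patterns `(F^t, T^{k-t})`, `7 ≤ k ≤ 2t`, `t < k`
(every other `κ` with `k ≥ 7` arms is one of these after sorting and a global colour flip,
`Nolin2008_prop17_quasiMult_of_steps`), i.e. Prop. 17 for `j ≥ 7`, whose printed proof is Thm. 11
with landing sequences of `j ≥ 7` sub-intervals of `∂S_N` (§4.2 Def. 8) — not expressible by the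
six sides of `Λ_N` used in `sepArms`.
The instances `k ≤ 2`, constant `κ` (every `k`) and `k = 4` two-and-two are proved outright and
not taken from `hsep` (`Nolin2008_prop17_quasiMult_of_residual`). [cite: Nolin2008, §4.5 Prop. 17 (proof) with §4.3 Thm. 11, Prop. 12 and §5.1 Prop. 20 (arXiv 0711.4948: Prop. 16, Thm. 10, Prop. 11, Prop. 19)] -/
theorem Nolin2008_prop17_quasiMult_of_sepArms_separation
    (hsep : ∀ {k : ℕ}, k ≤ 6 → ∀ κ : Fin k → Bool, ∃ c : ℝ, 0 < c ∧ ∃ n₀ : ℕ, ∀ n N : ℕ, n₀ ≤ n → 2 * n ≤ N →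
      c * polyArmProb κ n N ≤ (triSitePercolation half).real (sepArms κ n N))
    (h7 : ∀ k t : ℕ, 7 ≤ k → k ≤ 2 * t → t + 1 ≤ k →
      ∃ c : ℝ, 0 < c ∧ ∃ n₀ : ℕ, ∀ n₁ n₂ n₃ : ℕ, n₀ ≤ n₁ → n₁ < n₂ → n₂ < n₃ →
        c * (polyArmProb (fun i : Fin k => decide (t ≤ i.val)) n₁ n₂ *
          polyArmProb (fun i : Fin k => decide (t ≤ i.val)) n₂ n₃) ≤
          polyArmProb (fun i : Fin k => decide (t ≤ i.val)) n₁ n₃) :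
    Nolin2008_prop17_quasiMult :=
  Nolin2008_prop17_quasiMult_of_residual
    (polyArmProb_quasiMult_le_six_of_separation hsep (by norm_num) _)
    (polyArmProb_quasiMult_le_six_of_separation hsep (by norm_num) _)
    (polyArmProb_quasiMult_le_six_of_separation hsep (by norm_num) _)
    (polyArmProb_quasiMult_le_six_of_separation hsep (by norm_num) _)
    (polyArmProb_quasiMult_le_six_of_separation hsep (by norm_num) _)
    (polyArmProb_quasiMult_le_six_of_separation hsep (by norm_num) _)
    (polyArmProb_quasiMult_le_six_of_separation hsep (by norm_num) _)
    h7

/-- **Nolin 2008, Prop. 17 from its printed inputs, the seven remaining separation instances.**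
The same reduction with hypothesis (a) cut down to the seven colour patterns that are NOT already
proved, each stated for one convenient landed arrangement (Thm. 11 for that arrangement + Prop. 20):
`BBW` (`k = 3`), `BBBW` (`k = 4`), `BWBBW` (`k = 5`, multiset `{3, 2}` — literally the input `hsep`
of `Nolin2008_thm24_fiveArm_upper_of_separation`, so that ONE five-arm separation theorem serves
both named facts of `FiveArmExponentFacts.lean`), `BBBBW` (`k = 5`), `BWBWBW` (`k = 6`, multiset
`{3, 3}`, the alternating arrangement without equal-coloured neighbours, cf. `altSeparation_display`
for four arms), `BBWBBW` (`k = 6`, `{4, 2}`) and `BBBBBW` (`k = 6`); the order-free probabilities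
of the sorted patterns of `Nolin2008_prop17_quasiMult_of_residual` are those of these vectors
(`polyArmProb_FFT_eq_TTF`, …, colour flip and relabelling). [cite: Nolin2008, §4.5 Prop. 17 (proof) with §4.3 Thm. 11, Prop. 12 and §5.1 Prop. 20 (arXiv 0711.4948: Prop. 16, Thm. 10, Prop. 11, Prop. 19)] -/
theorem Nolin2008_prop17_quasiMult_of_sepArms_instances
    (h3 : ∃ c : ℝ, 0 < c ∧ ∃ n₀ : ℕ, ∀ n N : ℕ, n₀ ≤ n → 2 * n ≤ N →
      c * polyArmProb ![true, true, false] n N ≤ (triSitePercolation half).real (sepArms ![true, true, false] n N))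
    (h4 : ∃ c : ℝ, 0 < c ∧ ∃ n₀ : ℕ, ∀ n N : ℕ, n₀ ≤ n → 2 * n ≤ N →
      c * polyArmProb ![true, true, true, false] n N ≤ (triSitePercolation half).real (sepArms ![true, true, true, false] n N))
    (h5a : ∃ c : ℝ, 0 < c ∧ ∃ n₀ : ℕ, ∀ n N : ℕ, n₀ ≤ n → 2 * n ≤ N →
      c * polyArmProb ![true, false, true, true, false] n N ≤ (triSitePercolation half).real (sepArms ![true, false, true, true, false] n N))
    (h5b : ∃ c : ℝ, 0 < c ∧ ∃ n₀ : ℕ, ∀ n N : ℕ, n₀ ≤ n → 2 * n ≤ N →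
      c * polyArmProb ![true, true, true, true, false] n N ≤ (triSitePercolation half).real (sepArms ![true, true, true, true, false] n N))
    (h6a : ∃ c : ℝ, 0 < c ∧ ∃ n₀ : ℕ, ∀ n N : ℕ, n₀ ≤ n → 2 * n ≤ N →
      c * polyArmProb ![true, false, true, false, true, false] n N ≤ (triSitePercolation half).real (sepArms ![true, false, true, false, true, false] n N))
    (h6b : ∃ c : ℝ, 0 < c ∧ ∃ n₀ : ℕ, ∀ n N : ℕ, n₀ ≤ n → 2 * n ≤ N →
      c * polyArmProb ![true, true, false, true, true, false] n N ≤ (triSitePercolation half).real (sepArms ![true, true, false, true, true, false] n N))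
    (h6c : ∃ c : ℝ, 0 < c ∧ ∃ n₀ : ℕ, ∀ n N : ℕ, n₀ ≤ n → 2 * n ≤ N →
      c * polyArmProb ![true, true, true, true, true, false] n N ≤ (triSitePercolation half).real (sepArms ![true, true, true, true, true, false] n N))
    (h7 : ∀ k t : ℕ, 7 ≤ k → k ≤ 2 * t → t + 1 ≤ k →
      ∃ c : ℝ, 0 < c ∧ ∃ n₀ : ℕ, ∀ n₁ n₂ n₃ : ℕ, n₀ ≤ n₁ → n₁ < n₂ → n₂ < n₃ →
        c * (polyArmProb (fun i : Fin k => decide (t ≤ i.val)) n₁ n₂ *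
          polyArmProb (fun i : Fin k => decide (t ≤ i.val)) n₂ n₃) ≤
          polyArmProb (fun i : Fin k => decide (t ≤ i.val)) n₁ n₃) :
    Nolin2008_prop17_quasiMult :=
  Nolin2008_prop17_quasiMult_of_residual
    (polyArmProb_quasiMult_congr polyArmProb_FFT_eq_TTF
      (polyArmProb_quasiMult_of_sepArms_separation (by norm_num) _ h3))
    (polyArmProb_quasiMult_congr polyArmProb_FFFT_eq_TTTF
      (polyArmProb_quasiMult_of_sepArms_separation (by norm_num) _ h4))
    (polyArmProb_quasiMult_congr polyArmProb_FFFTT_eq_TFTTF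
      (polyArmProb_quasiMult_of_sepArms_separation (by norm_num) _ h5a))
    (polyArmProb_quasiMult_congr polyArmProb_FFFFT_eq_TTTTF
      (polyArmProb_quasiMult_of_sepArms_separation (by norm_num) _ h5b))
    (polyArmProb_quasiMult_congr polyArmProb_FFFTTT_eq_TFTFTF
      (polyArmProb_quasiMult_of_sepArms_separation (by norm_num) _ h6a))
    (polyArmProb_quasiMult_congr polyArmProb_FFFFTT_eq_TTFTTF
      (polyArmProb_quasiMult_of_sepArms_separation (by norm_num) _ h6b))
    (polyArmProb_quasiMult_congr polyArmProb_FFFFFT_eq_TTTTTF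
      (polyArmProb_quasiMult_of_sepArms_separation (by norm_num) _ h6c))
    h7

/-- **The five-arm clause of Prop. 17 consumed by the tree's two-radii bound `FiveArmUpperT`, from
five-arm separation.**  The only dependents of `Nolin2008_prop17_quasiMult` (2026-08-17:
`fiveArmUpperT_of_pointBound_of_quasiMult`, `Summits/CriticalPhenomena/CardyFormulaZ2`) use its
clause at `κ = (T,F,T,F,F)` alone; that clause follows from the single separation input `hsep` of
`Nolin2008_thm24_fiveArm_upper_of_separation` — Nolin's Thm. 11 [arXiv Thm. 10] with Prop. 20
[arXiv Prop. 19] for five arms onto `sepArms (T,F,T,T,F)` — by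
`polyArmProb_quasiMult_of_sepArms_separation` (Prop. 12 gluing, `SepArmsQuasiMult.lean`) and
`polyArmProb_TFTFF_eq_TFTTF` (the order-free event only sees the colour multiset, up to a global
flip at `p = 1/2`).  So both named facts of `FiveArmExponentFacts.lean` enter that consumer through
ONE five-arm separation theorem (plus the colour switching `hsw` for Thm. 24). [cite: Nolin2008, §4.5 Prop. 17 (proof) with §4.3 Thm. 11, Prop. 12 and §5.1 Prop. 20 (arXiv 0711.4948: Prop. 16, Thm. 10, Prop. 11, Prop. 19)] -/
theorem fiveArm_quasiMult_TFTFF_of_sepArms_separation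
    (hsep : ∃ c : ℝ, 0 < c ∧ ∃ n₀ : ℕ, ∀ n N : ℕ, n₀ ≤ n → 2 * n ≤ N →
      c * polyArmProb ![true, false, true, true, false] n N ≤
        (triSitePercolation half).real (sepArms ![true, false, true, true, false] n N)) :
    ∃ c : ℝ, 0 < c ∧ ∃ n₀ : ℕ, ∀ n₁ n₂ n₃ : ℕ, n₀ ≤ n₁ → n₁ < n₂ → n₂ < n₃ →
      c * (polyArmProb ![true, false, true, false, false] n₁ n₂ *
        polyArmProb ![true, false, true, false, false] n₂ n₃) ≤
        polyArmProb ![true, false, true, false, false] n₁ n₃ :=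
  polyArmProb_quasiMult_congr polyArmProb_TFTFF_eq_TFTTF
    (polyArmProb_quasiMult_of_sepArms_separation (by norm_num) _ hsep)

/-! ### Colour switching proved: the five-arm upper bound from two arm-separation inputs -/

/-- **The colour switching `hsw`, from five-arm separation for `σ₁ = BWWWW`.** Nolin's Prop. 20
[arXiv Prop. 19] for five arms between the colour counts `(1, 4)` and `(3, 2) ~ (2, 3)`, in the
landed form `hsw` consumed by `Nolin2008_thm24_fiveArm_upper_of_landedExt`, follows from arm
separation (Thm. 11 [arXiv Thm. 10]) for `(5, σ₁)` onto the well-separated event `sepArms σ₁` of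
`SepArmsGlue.lean`: for `2n ≤ N`, `c · π_{σ₁}(n, N) ≤ P(sepArms σ₁ n N) ≤ π_{(B,W,B,B,W)}(n, N)`
by the double-exploration flip of `FlipFiveArm.lean` (`FiveArmFlip.real_sepArms_oneFour_le_polyArmProb`,
PROVED there: Nolin's "condition on any set of consecutive arms … then flip the remaining region"),
and `π_{(B,W,B,B,W)} = π_{(B,W,B,W,W)}` (`polyArmProb_TFTFF_eq_TFTTF`); for `n ≤ N < 2n` the
right-hand side is bounded below by a constant (`exists_le_polyArmProb_of_le_mul`, RSW). [cite: Nolin2008, §5.1 Prop. 20 with §4.3 Thm. 11 (arXiv 0711.4948: Prop. 19, Thm. 10)] [cite: KestenSidoraviciusZhang1998, Lemma 5, (3.14)–(3.15)] -/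
theorem fiveArm_switch_of_sepArms_separation
    (hsep₁ : ∃ c : ℝ, 0 < c ∧ ∃ n₀ : ℕ, ∀ n N : ℕ, n₀ ≤ n → 2 * n ≤ N →
      c * polyArmProb ![true, false, false, false, false] n N ≤
        (triSitePercolation half).real (sepArms ![true, false, false, false, false] n N)) :
    ∃ c : ℝ, 0 < c ∧ ∃ n₀ : ℕ, ∀ n N : ℕ, n₀ ≤ n → n ≤ N →
      c * polyArmProb ![true, false, false, false, false] n N ≤ polyArmProb ![true, false, true, false, false] n N := by
  obtain ⟨c, hc, n₀, h⟩ := hsep₁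
  obtain ⟨a, ha, hbd⟩ := exists_le_polyArmProb_of_le_mul (k := 5) (by norm_num) ![true, false, true, false, false] 2 (by norm_num)
  refine ⟨min c a, lt_min hc ha, max n₀ 4, fun n N hn hnN => ?_⟩
  have hn₀ : n₀ ≤ n := le_trans (le_max_left _ _) hn
  have h4 : 4 ≤ n := le_trans (le_max_right _ _) hn
  have hπ := polyArmProb_nonneg ![true, false, false, false, false] n N
  by_cases h2 : 2 * n ≤ N
  · calc min c a * polyArmProb ![true, false, false, false, false] n N
        ≤ c * polyArmProb ![true, false, false, false, false] n N :=
          mul_le_mul_of_nonneg_right (min_le_left _ _) hπ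
      _ ≤ (triSitePercolation half).real (sepArms ![true, false, false, false, false] n N) := h n N hn₀ h2
      _ ≤ polyArmProb ![true, false, true, true, false] n N := FiveArmFlip.real_sepArms_oneFour_le_polyArmProb h4 h2
      _ = polyArmProb ![true, false, true, false, false] n N := (polyArmProb_TFTFF_eq_TFTTF n N).symm
  · calc min c a * polyArmProb ![true, false, false, false, false] n N ≤ a * 1 :=
          mul_le_mul (min_le_right _ _) (polyArmProb_le_one _ n N) hπ ha.le
      _ = a := mul_one a
      _ ≤ polyArmProb ![true, false, true, false, false] n N := hbd n N (by omega) hnN (by omega)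

/-- **Nolin's Thm. 24, five-arm item, from arm separation alone** (Nolin 2008, §5.2, proof of
Thm. 24 [arXiv 0711.4948: Thm. 23 (iii), pp. 16–17]): the named fact `Nolin2008_thm24_fiveArm_upper`
follows from Nolin's Thm. 11 [arXiv Thm. 10] for five arms in the tree's format — separation of
`armEvent κ n N` onto the well-separated event `sepArms κ n N` at constant cost, `n₀ ≤ n`, `2n ≤ N` —
for the two colour vectors `κ = (B,W,B,B,W)` (`hsep`, feeding the landed extension, uniqueness and
counting, `Nolin2008_thm24_fiveArm_upper_of_separation`) and `κ = (B,W,W,W,W)` (`hsep₁`, feeding the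
proved colour switching `fiveArm_switch_of_sepArms_separation`).  Everything else in the printed
proof — extendability (Prop. 12), the RSW gluing (Lemma 13), colour exchange (Prop. 20), uniqueness
(Prop. 18 / KSZ Lemma 5) and the `O(n²)` counting — is proved in the tree. [cite: Nolin2008, §5.2 Thm. 24 (five-arm item) with §4.3 Thm. 11, Prop. 12, Lemma 13, §5.1 Prop. 18, Prop. 20 (arXiv 0711.4948: Thm. 23 (iii), Thm. 10, Prop. 11, Lemma 12, Prop. 17, Prop. 19)] [cite: KestenSidoraviciusZhang1998, Lemma 5, (3.10)–(3.15)] -/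
theorem Nolin2008_thm24_fiveArm_upper_of_separations
    (hsep : ∃ c : ℝ, 0 < c ∧ ∃ n₀ : ℕ, ∀ n N : ℕ, n₀ ≤ n → 2 * n ≤ N →
      c * polyArmProb ![true, false, true, true, false] n N ≤
        (triSitePercolation half).real (sepArms ![true, false, true, true, false] n N))
    (hsep₁ : ∃ c : ℝ, 0 < c ∧ ∃ n₀ : ℕ, ∀ n N : ℕ, n₀ ≤ n → 2 * n ≤ N →
      c * polyArmProb ![true, false, false, false, false] n N ≤
        (triSitePercolation half).real (sepArms ![true, false, false, false, false] n N)) :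
    Nolin2008_thm24_fiveArm_upper :=
  Nolin2008_thm24_fiveArm_upper_of_separation hsep (fiveArm_switch_of_sepArms_separation hsep₁)

/-! ### The fact from Nolin's induction on scales: the two five-arm surgeries are the exact remaining inputs -/

/-- **The recorded fact from arm separation for all patterns with `k ≤ 6` arms** — hypothesis (a)
of `Nolin2008_prop17_quasiMult_of_sepArms_separation` (Nolin's Thm. 11 with Prop. 20 in the tree's
format, uniformly in the pattern): its instances at `(B,W,B,B,W)` and `(B,W,W,W,W)` feed
`Nolin2008_thm24_fiveArm_upper_of_separations`. So ONE separation theorem in the tree's format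
discharges both named facts of `FiveArmExponentFacts.lean` for `k ≤ 6`. [cite: Nolin2008, §5.2 Thm. 24 (five-arm item) with §4.3 Thm. 11 and §5.1 Prop. 20 (arXiv 0711.4948: Thm. 23 (iii), Thm. 10, Prop. 19)] -/
theorem Nolin2008_thm24_fiveArm_upper_of_sepArms_separation_all
    (hsep : ∀ {k : ℕ}, k ≤ 6 → ∀ κ : Fin k → Bool, ∃ c : ℝ, 0 < c ∧ ∃ n₀ : ℕ, ∀ n N : ℕ, n₀ ≤ n → 2 * n ≤ N →
      c * polyArmProb κ n N ≤ (triSitePercolation half).real (sepArms κ n N)) :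
    Nolin2008_thm24_fiveArm_upper :=
  Nolin2008_thm24_fiveArm_upper_of_separations (hsep (by norm_num) _) (hsep (by norm_num) _)

/-- **The recorded fact from the two five-arm SURGERIES of Nolin's induction on scales** (Nolin
2008, proof of Thm. 11, §4.4 [arXiv 0711.4948: Thm. 10, Lemma 14, pp. 11–13]: "with probability
`≥ 1 - δ` any set of disjoint crossings can be made `η'`-well-separated", external and internal
extremities): the separation inputs `hsep`, `hsep₁` of `Nolin2008_thm24_fiveArm_upper_of_separations`
are the conclusions of the tree's general-pattern scheme `sepArmsOn_separation_of_surgeries`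
(`SepArmsOnScheme.lean`, Nolin's induction with the extension, RSW and bounded-ratio inputs proved
there) for `κ = (B,W,B,B,W)` and `κ = (B,W,W,W,W)` on the sides `0, …, 4`
(`sepArms κ = sepArmsOn κ (Fin.castLE _)`, `sepArms_eq_sepArmsOn`), fed by the outer surgery
`hOut`/`hOut₁` and the inner surgery `hIn`/`hIn₁` of the pattern, in the exact shape of that
scheme (for four alternating arms these are `real_altFourArm_le_outStepFr_at` with
`real_not_outGoodFr_le_at`, `real_outMidTiny4_le_at`, and `real_extFourArmQ_le_step4_at` with
`real_not_inGoodF_le_at`, `real_intTinyExt4_le_at`). These two surgeries per pattern are thus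
the only inputs of the printed proof of the five-arm item of Thm. 24 not yet in the tree. [cite: Nolin2008, §4.4 Thm. 11 (proof, Lemma 14) and §5.2 Thm. 24 (arXiv 0711.4948: Thm. 10, Lemma 14, Thm. 23 (iii))] -/
theorem Nolin2008_thm24_fiveArm_upper_of_surgeries
    (hOut : ∀ ε : ℝ, 0 < ε → ∃ (G : ℕ → ℕ → Set (SiteConfig (Site 2))) (C₁ : ℝ) (n₀ : ℕ), 0 ≤ C₁ ∧
      (∀ n M : ℕ, n₀ ≤ n → 2 * n ≤ M →
        (triSitePercolation half).real (armEvent ![true, false, true, true, false] n (2 * M)) ≤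
          (triSitePercolation half).real (G n M) + ε * (triSitePercolation half).real (armEvent ![true, false, true, true, false] n M)) ∧
      (∀ n M : ℕ, n₀ ≤ n → 2 * n ≤ M →
        (triSitePercolation half).real (G n M) ≤
          C₁ * (triSitePercolation half).real (extArmsOn ![true, false, true, true, false] (Fin.castLE (Nat.le_succ 5)) n (4 * M))))
    (hIn : ∀ ε : ℝ, 0 < ε → ∃ (G : ℕ → ℕ → Set (SiteConfig (Site 2))) (C₁ : ℝ) (n₀ : ℕ), 0 ≤ C₁ ∧
      (∀ m N : ℕ, n₀ ≤ m → 2 * (2 * m + 1) ≤ N →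
        (triSitePercolation half).real (extArmsOn ![true, false, true, true, false] (Fin.castLE (Nat.le_succ 5)) m N) ≤
          (triSitePercolation half).real (G m N) +
            ε * (triSitePercolation half).real (extArmsOn ![true, false, true, true, false] (Fin.castLE (Nat.le_succ 5)) (2 * m + 1) N)) ∧
      (∀ m N : ℕ, n₀ ≤ m → 2 * (2 * m + 1) ≤ N →
        (triSitePercolation half).real (G (2 * m + 1) N) ≤
          C₁ * (triSitePercolation half).real (sepArmsOn ![true, false, true, true, false] (Fin.castLE (Nat.le_succ 5)) m N)))
    (hOut₁ : ∀ ε : ℝ, 0 < ε → ∃ (G : ℕ → ℕ → Set (SiteConfig (Site 2))) (C₁ : ℝ) (n₀ : ℕ), 0 ≤ C₁ ∧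
      (∀ n M : ℕ, n₀ ≤ n → 2 * n ≤ M →
        (triSitePercolation half).real (armEvent ![true, false, false, false, false] n (2 * M)) ≤
          (triSitePercolation half).real (G n M) + ε * (triSitePercolation half).real (armEvent ![true, false, false, false, false] n M)) ∧
      (∀ n M : ℕ, n₀ ≤ n → 2 * n ≤ M →
        (triSitePercolation half).real (G n M) ≤
          C₁ * (triSitePercolation half).real (extArmsOn ![true, false, false, false, false] (Fin.castLE (Nat.le_succ 5)) n (4 * M))))
    (hIn₁ : ∀ ε : ℝ, 0 < ε → ∃ (G : ℕ → ℕ → Set (SiteConfig (Site 2))) (C₁ : ℝ) (n₀ : ℕ), 0 ≤ C₁ ∧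
      (∀ m N : ℕ, n₀ ≤ m → 2 * (2 * m + 1) ≤ N →
        (triSitePercolation half).real (extArmsOn ![true, false, false, false, false] (Fin.castLE (Nat.le_succ 5)) m N) ≤
          (triSitePercolation half).real (G m N) +
            ε * (triSitePercolation half).real (extArmsOn ![true, false, false, false, false] (Fin.castLE (Nat.le_succ 5)) (2 * m + 1) N)) ∧
      (∀ m N : ℕ, n₀ ≤ m → 2 * (2 * m + 1) ≤ N →
        (triSitePercolation half).real (G (2 * m + 1) N) ≤
          C₁ * (triSitePercolation half).real (sepArmsOn ![true, false, false, false, false] (Fin.castLE (Nat.le_succ 5)) m N)))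
    : Nolin2008_thm24_fiveArm_upper :=
  Nolin2008_thm24_fiveArm_upper_of_separations
    (sepArmsOn_separation_of_surgeries ![true, false, true, true, false] (Fin.castLE (Nat.le_succ 5))
      (Fin.castLE_injective _) hOut hIn)
    (sepArmsOn_separation_of_surgeries ![true, false, false, false, false] (Fin.castLE (Nat.le_succ 5))
      (Fin.castLE_injective _) hOut₁ hIn₁)

end Literature.Probability.Percolation

/-! ## The discharge of `Nolin2008_thm24_fiveArm_upper` (`α₅ ≤ 2`): the arrangement `B W W W W`,
the classification of the landing tuples, and the assembly -/

noncomputable section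

open MeasureTheory Set

namespace Literature.Probability.Percolation

open LatticeModels Gadget

/-! ### The arrangement `B W W W W` -/

/-- **The five-arm upper bound for plain arms in the arrangement `B W W W W`.** For every core radius
`m ≥ 4` there is `C` such that for all landing indices `i` with `GadgetIdx m i` and all `n ≥ m`,
`P_{1/2}(plainArms (B,W,W,W,W) (rp m ∘ i) m n) ≤ C / n²`. [cite: Nolin2008, §5.1 Prop. 20 with §5.2 Thm. 24, five-arm item (arXiv 0711.4948: Prop. 19, Thm. 23 (iii))] -/
theorem real_plainArms_B4W_le {m : ℕ} (hm : 4 ≤ m) :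
    ∃ C : ℝ, ∀ i : Fin 5 → ℕ, GadgetIdx m i → ∀ n : ℕ, m ≤ n →
      (triSitePercolation half).real (plainArms ![true, false, false, false, false] (sOf m i) m n) ≤ C / (n : ℝ) ^ 2 := by
  classical
  obtain ⟨C₀, hC₀⟩ := exists_real_plainArms_E_le hm
  set CE := max C₀ 0 with hCE
  have hCE0 : 0 ≤ CE := le_max_right _ _
  have hE : ∀ i : Fin 5 → ℕ, GadgetIdx m i → ∀ n : ℕ, m ≤ n →
      (triSitePercolation half).real (plainArms κE (sOf m i) m n) ≤ CE / (n : ℝ) ^ 2 := fun i hi n hn =>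
    (hC₀ i hi n hn).trans (div_le_div_of_nonneg_right (le_max_left _ _) (by positivity))
  set K : ℝ := 2 ^ (triBall m).card * ((6 * m) * (6 * m)) * (4 * CE) with hK
  have hK0 : 0 ≤ K := by positivity
  refine ⟨K + ((m : ℝ) + 2) ^ 2, fun i hi n hmn => ?_⟩
  set μ := triSitePercolation half with hμ
  have hm4 := hi.four_le; have hbase := hi.base
  have h01 := hi.lt01; have h12 := hi.lt12; have h23 := hi.lt23; have h34 := hi.lt34; have h40 := hi.lt40
  have hk : 1 ≤ m := by omega
  have hn : (0 : ℝ) < n := by exact_mod_cast (show 0 < n by omega)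
  have hn2 : (0 : ℝ) < (n : ℝ) ^ 2 := by positivity
  by_cases hsmall : n < m + 2
  · calc μ.real (plainArms ![true, false, false, false, false] (sOf m i) m n) ≤ 1 := measureReal_le_one
      _ ≤ ((m : ℝ) + 2) ^ 2 / (n : ℝ) ^ 2 := by
          rw [le_div_iff₀ hn2, one_mul]
          have : (n : ℝ) ≤ m + 2 := by exact_mod_cast (by omega : n ≤ m + 2)
          exact pow_le_pow_left₀ hn.le this 2
      _ ≤ (K + ((m : ℝ) + 2) ^ 2) / (n : ℝ) ^ 2 := div_le_div_of_nonneg_right (by linarith) hn2.le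
  push Not at hsmall
  -- the index family of the image events
  set I : ℕ × ℕ → Fin 5 → ℕ := fun kk => ![i 0, kk.1, i 2, i 3, kk.2] with hI
  set Idx : Finset (ℕ × ℕ) := Finset.Ioo (i 0) (i 2) ×ˢ Finset.Ioo (i 3) (i 0 + 6 * m) with hIdx
  set B : Set (SiteConfig (Site 2)) := ⋃ kk ∈ Idx, plainArms ![true, false, true, true, false] (sOf m (I kk)) m (n - 1) with hB
  -- finite energy
  set Src := plainArms ![true, false, false, false, false] (sOf m i) m n ∩ paint (coreOf (sOf m i) m) ∅ with hSrc
  have hfe : μ.real (plainArms ![true, false, false, false, false] (sOf m i) m n) ≤ 2 ^ (triBall m).card * μ.real Src := by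
    rw [hμ, real_plainArms_eq_mul_paint _ (sOf m i) m n ∅]
    refine mul_le_mul_of_nonneg_right ?_ measureReal_nonneg
    exact pow_le_pow_right₀ (by norm_num) (card_coreOf_le _ _)
  -- the flip
  have hSrcB : Src ⊆ InnerFlip2.flip₂ m n i ⁻¹' B := by
    rintro ω ⟨hω, hpaint⟩
    obtain ⟨k, k', hk1, hk2, hk'1, hk'2, hmem⟩ := InnerFlip2.flip₂_mem hi hsmall hω hpaint
    show InnerFlip2.flip₂ m n i ω ∈ B
    rw [hB]
    simp only [Set.mem_iUnion, exists_prop]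
    exact ⟨(k, k'), by rw [hIdx, Finset.mem_product, Finset.mem_Ioo, Finset.mem_Ioo]; exact ⟨⟨hk1, hk2⟩, hk'1, hk'2⟩, hmem⟩
  have hBdet : DeterminedBy B ↑(triBall (n - 1)) := by
    refine determinedBy_biUnion_finset fun kk _ => determinedBy_plainArms_ball _ fun j => ?_
    show triNorm (rp m (I kk j)) ≤ ((n - 1 : ℕ) : ℤ)
    rw [triNorm_rp hk]; omega
  have hflip : μ.real Src ≤ μ.real B :=
    (measureReal_mono hSrcB).trans (le_of_eq (InnerFlip2.real_preimage_flip₂ hi hsmall hBdet))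
  -- union bound and the `B W B W W` bound for each term
  have hn1 : m ≤ n - 1 := by omega
  have hterm : ∀ kk ∈ Idx, μ.real (plainArms ![true, false, true, true, false] (sOf m (I kk)) m (n - 1)) ≤ CE / ((n - 1 : ℕ) : ℝ) ^ 2 := by
    rintro ⟨k, k'⟩ hkk
    rw [hIdx, Finset.mem_product, Finset.mem_Ioo, Finset.mem_Ioo] at hkk
    obtain ⟨⟨hk1, hk2⟩, hk'1, hk'2⟩ := hkk
    set J : Fin 5 → ℕ := ![k', i 0 + 6 * m, k + 6 * m, i 2 + 6 * m, i 3 + 6 * m] with hJ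
    have hJidx : GadgetIdx m J :=
      { four_le := hm4, base := by show 6 * m ≤ k'; omega, lt01 := by show k' < i 0 + 6 * m; omega,
        lt12 := by show i 0 + 6 * m < k + 6 * m; omega, lt23 := by show k + 6 * m < i 2 + 6 * m; omega,
        lt34 := by show i 2 + 6 * m < i 3 + 6 * m; omega, lt40 := by show i 3 + 6 * m < k' + 6 * m; omega }
    let σ : Fin 5 ≃ Fin 5 := finRotate 5 |>.symm
    have hκ : (fun j => !(![true, false, true, true, false] : Fin 5 → Bool) j) ∘ σ = κE := by
      funext j; fin_cases j <;> rfl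
    have hs : sOf m (I (k, k')) ∘ σ = sOf m J := by
      funext j
      fin_cases j
      · rfl
      · show rp m (i 0) = rp m (i 0 + 6 * m); rw [rp_add_period]
      · show rp m k = rp m (k + 6 * m); rw [rp_add_period]
      · show rp m (i 2) = rp m (i 2 + 6 * m); rw [rp_add_period]
      · show rp m (i 3) = rp m (i 3 + 6 * m); rw [rp_add_period]
    calc μ.real (plainArms ![true, false, true, true, false] (sOf m (I (k, k'))) m (n - 1))
        ≤ μ.real (plainArms (fun j => !(![true, false, true, true, false] : Fin 5 → Bool) j) (sOf m (I (k, k'))) m (n - 1)) :=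
          real_plainArms_le_not _ _ _ _
      _ ≤ μ.real (plainArms κE (sOf m J) m (n - 1)) := by
          rw [← hκ, ← hs]; exact measureReal_mono (plainArms_subset_reindex σ _ _ _ _)
      _ ≤ CE / ((n - 1 : ℕ) : ℝ) ^ 2 := hE J hJidx (n - 1) hn1
  have hcard : ((Idx.card : ℕ) : ℝ) ≤ (6 * m) * (6 * m) := by
    rw [hIdx, Finset.card_product, Nat.card_Ioo, Nat.card_Ioo]
    have h1 : i 2 - i 0 - 1 ≤ 6 * m := by omega
    have h2 : i 0 + 6 * m - i 3 - 1 ≤ 6 * m := by omega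
    exact_mod_cast Nat.mul_le_mul h1 h2
  have hn1R : ((n : ℝ) ^ 2) ≤ 4 * ((n - 1 : ℕ) : ℝ) ^ 2 := by
    have h1 : ((n - 1 : ℕ) : ℝ) = n - 1 := by push_cast [Nat.cast_sub (show 1 ≤ n by omega)]; ring
    rw [h1]
    have : (2 : ℝ) ≤ n := by exact_mod_cast (show 2 ≤ n by omega)
    nlinarith
  have hn1pos : (0 : ℝ) < ((n - 1 : ℕ) : ℝ) ^ 2 := by
    have : (1 : ℝ) ≤ ((n - 1 : ℕ) : ℝ) := by exact_mod_cast (show 1 ≤ n - 1 by omega)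
    positivity
  have hBle : μ.real B ≤ (6 * m) * (6 * m) * (CE / ((n - 1 : ℕ) : ℝ) ^ 2) := by
    calc μ.real B ≤ ∑ kk ∈ Idx, μ.real (plainArms ![true, false, true, true, false] (sOf m (I kk)) m (n - 1)) :=
          measureReal_biUnion_finset_le _ _
      _ ≤ ∑ kk ∈ Idx, CE / ((n - 1 : ℕ) : ℝ) ^ 2 := Finset.sum_le_sum hterm
      _ = Idx.card * (CE / ((n - 1 : ℕ) : ℝ) ^ 2) := by rw [Finset.sum_const, nsmul_eq_mul]
      _ ≤ (6 * m) * (6 * m) * (CE / ((n - 1 : ℕ) : ℝ) ^ 2) := mul_le_mul_of_nonneg_right hcard (by positivity)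
  have hinv : CE / ((n - 1 : ℕ) : ℝ) ^ 2 ≤ 4 * CE / (n : ℝ) ^ 2 := by
    rw [div_le_div_iff₀ hn1pos hn2]
    nlinarith
  calc μ.real (plainArms ![true, false, false, false, false] (sOf m i) m n)
      ≤ 2 ^ (triBall m).card * μ.real Src := hfe
    _ ≤ 2 ^ (triBall m).card * ((6 * m) * (6 * m) * (4 * CE / (n : ℝ) ^ 2)) := by
        refine mul_le_mul_of_nonneg_left (hflip.trans (hBle.trans ?_)) (by positivity)
        exact mul_le_mul_of_nonneg_left hinv (by positivity)
    _ = K / (n : ℝ) ^ 2 := by rw [hK]; ring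
    _ ≤ (K + ((m : ℝ) + 2) ^ 2) / (n : ℝ) ^ 2 := div_le_div_of_nonneg_right (le_add_of_nonneg_right (by positivity)) hn2.le

/-! ### Reading a sorted index tuple from a position -/

/-- **The landing indices read anticlockwise from a position** of a sorted tuple `a` (one period
added, a second one past the end) are landing indices. [folklore] -/
theorem gadgetIdx_read {m : ℕ} (hm : 4 ≤ m) {a : Fin 5 → ℕ} (h01 : a 0 < a 1) (h12 : a 1 < a 2) (h23 : a 2 < a 3)
    (h34 : a 3 < a 4) (h4 : a 4 < 6 * m) (r : Fin 5) :
    GadgetIdx m ((![![a 0 + 6 * m, a 1 + 6 * m, a 2 + 6 * m, a 3 + 6 * m, a 4 + 6 * m],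
      ![a 1 + 6 * m, a 2 + 6 * m, a 3 + 6 * m, a 4 + 6 * m, a 0 + 12 * m],
      ![a 2 + 6 * m, a 3 + 6 * m, a 4 + 6 * m, a 0 + 12 * m, a 1 + 12 * m],
      ![a 3 + 6 * m, a 4 + 6 * m, a 0 + 12 * m, a 1 + 12 * m, a 2 + 12 * m],
      ![a 4 + 6 * m, a 0 + 12 * m, a 1 + 12 * m, a 2 + 12 * m, a 3 + 12 * m]] : Fin 5 → Fin 5 → ℕ) r) := by
  fin_cases r <;> exact
    { four_le := hm, base := by simp, lt01 := by simp; omega, lt12 := by simp; omega,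
      lt23 := by simp; omega, lt34 := by simp; omega, lt40 := by simp; omega }

/-- **The sites of the read tuple are the original sites, rotated.** [folklore] -/
theorem sOf_read (m : ℕ) (a : Fin 5 → ℕ) (r : Fin 5) :
    (fun j => rp m (a j)) ∘ (Equiv.addRight r) = sOf m ((![![a 0 + 6 * m, a 1 + 6 * m, a 2 + 6 * m, a 3 + 6 * m, a 4 + 6 * m],
      ![a 1 + 6 * m, a 2 + 6 * m, a 3 + 6 * m, a 4 + 6 * m, a 0 + 12 * m],
      ![a 2 + 6 * m, a 3 + 6 * m, a 4 + 6 * m, a 0 + 12 * m, a 1 + 12 * m],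
      ![a 3 + 6 * m, a 4 + 6 * m, a 0 + 12 * m, a 1 + 12 * m, a 2 + 12 * m],
      ![a 4 + 6 * m, a 0 + 12 * m, a 1 + 12 * m, a 2 + 12 * m, a 3 + 12 * m]] : Fin 5 → Fin 5 → ℕ) r) := by
  funext j
  simp only [Function.comp, Equiv.coe_addRight, sOf]
  have h12 : ∀ x, rp m (x + 12 * m) = rp m x := fun x => by rw [show x + 12 * m = x + 2 * (6 * m) by ring, rp_add_mul_period]
  fin_cases r <;> fin_cases j <;> simp [rp_add_period, h12]

/-! ### Tuples with a repeated site -/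

/-- **A landing tuple with a repeated site carries no plain arms.** [folklore] -/
theorem plainArms_eq_empty_of_not_injective {k : ℕ} (κ : Fin k → Bool) {s : Fin k → Site 2} (hs : ¬ Function.Injective s)
    (m n : ℕ) : plainArms κ s m n = ∅ := by
  classical
  ext ω
  simp only [Set.mem_empty_iff_false, iff_false]
  rintro ⟨y, w, -, hd⟩
  apply hs
  intro a b hab
  by_contra hne
  have := Finset.disjoint_left.1 (hd hne) (List.mem_toFinset.2 (w a).start_mem_support)
  rw [hab] at this
  exact this (List.mem_toFinset.2 (w b).start_mem_support)

/-! ### Every landing tuple -/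

set_option maxHeartbeats 4000000 in
/-- **Plain five arms from ANY landing tuple have probability `≤ C(m)/n²`**, for the colours
`(B,W,W,W,W)` and `(B,W,B,W,W)`: sorted anticlockwise and read from the right landing, an injective
tuple is in one of the three arrangements `B W W W W`, `B W W W B`, `B W B W W`. [cite: Nolin2008, §5.1 Prop. 20 with §5.2 Thm. 24, five-arm item (arXiv 0711.4948: Prop. 19, Thm. 23 (iii))] -/
theorem exists_real_plainArms_le {m : ℕ} (hm : 4 ≤ m) :
    ∃ C : ℝ, ∀ n : ℕ, m ≤ n → ∀ κ : Fin 5 → Bool,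
      (κ = ![true, false, false, false, false] ∨ κ = ![true, false, true, false, false]) →
      ∀ s : Fin 5 → Site 2, (∀ j, s j ∈ triSphere m) →
      (triSitePercolation half).real (plainArms κ s m n) ≤ C / (n : ℝ) ^ 2 := by
  classical
  obtain ⟨CE, hCE⟩ := exists_real_plainArms_E_le hm
  obtain ⟨CB, hCB⟩ := real_plainArms_BB_le hm
  obtain ⟨CW, hCW⟩ := real_plainArms_B4W_le hm
  set C := max (max CE CB) (max CW 0) with hC
  refine ⟨C, fun n hmn κ hκ s hs => ?_⟩
  set μ := triSitePercolation half with hμ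
  have hk : 1 ≤ m := by omega
  have hn2 : (0 : ℝ) ≤ C / (n : ℝ) ^ 2 := div_nonneg (le_trans (le_max_right _ _) (le_max_right _ _)) (by positivity)
  -- tuples with a repeated site
  by_cases hinj : Function.Injective s
  swap
  · rw [plainArms_eq_empty_of_not_injective κ hinj, measureReal_empty]; exact hn2
  -- ring indices, sorted
  have hidx : ∀ j, ∃ k, k < 6 * m ∧ s j = rp m k := fun j => by
    obtain ⟨k, hk', e⟩ := exists_eq_rp hk (mem_triSphere_iff.1 (hs j)); exact ⟨k, hk', e⟩
  choose k hk6 hsk using hidx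
  have hkinj : Function.Injective k := fun a b hab => hinj (by rw [hsk a, hsk b, hab])
  set σ₀ := Tuple.sort k with hσ₀
  set a : Fin 5 → ℕ := k ∘ σ₀ with ha
  have hamono : StrictMono a := (Tuple.monotone_sort k).strictMono_of_injective (hkinj.comp σ₀.injective)
  have h01 : a 0 < a 1 := hamono (by decide)
  have h12 : a 1 < a 2 := hamono (by decide)
  have h23 : a 2 < a 3 := hamono (by decide)
  have h34 : a 3 < a 4 := hamono (by decide)
  have h4 : a 4 < 6 * m := hk6 _
  have hsσ : s ∘ σ₀ = fun j => rp m (a j) := funext fun j => hsk _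
  -- the three bounds, read from a position
  have three : ∀ (r : Fin 5) (X : Fin 5 → Bool),
      (X = κE ∨ X = ![true, false, false, false, true] ∨ X = ![true, false, false, false, false]) →
      (κ ∘ σ₀) ∘ Equiv.addRight r = X → μ.real (plainArms κ s m n) ≤ C / (n : ℝ) ^ 2 := by
    intro r X hX hrX
    have hI := gadgetIdx_read hm h01 h12 h23 h34 h4 r
    calc μ.real (plainArms κ s m n) ≤ μ.real (plainArms (κ ∘ σ₀) (s ∘ σ₀) m n) :=
          measureReal_mono (plainArms_subset_reindex σ₀ κ s m n)
      _ ≤ μ.real (plainArms ((κ ∘ σ₀) ∘ Equiv.addRight r) ((s ∘ σ₀) ∘ Equiv.addRight r) m n) :=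
          measureReal_mono (plainArms_subset_reindex (Equiv.addRight r) _ _ m n)
      _ = μ.real (plainArms X (sOf m ((![![a 0 + 6 * m, a 1 + 6 * m, a 2 + 6 * m, a 3 + 6 * m, a 4 + 6 * m],
      ![a 1 + 6 * m, a 2 + 6 * m, a 3 + 6 * m, a 4 + 6 * m, a 0 + 12 * m],
      ![a 2 + 6 * m, a 3 + 6 * m, a 4 + 6 * m, a 0 + 12 * m, a 1 + 12 * m],
      ![a 3 + 6 * m, a 4 + 6 * m, a 0 + 12 * m, a 1 + 12 * m, a 2 + 12 * m],
      ![a 4 + 6 * m, a 0 + 12 * m, a 1 + 12 * m, a 2 + 12 * m, a 3 + 12 * m]] : Fin 5 → Fin 5 → ℕ) r)) m n) := by rw [hrX, hsσ, sOf_read]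
      _ ≤ C / (n : ℝ) ^ 2 := by
          rcases hX with rfl | rfl | rfl
          · exact (hCE _ hI n hmn).trans (div_le_div_of_nonneg_right (le_trans (le_max_left _ _) (le_max_left _ _)) (by positivity))
          · exact (hCB _ hI n hmn).trans (div_le_div_of_nonneg_right (le_trans (le_max_right _ _) (le_max_left _ _)) (by positivity))
          · exact (hCW _ hI n hmn).trans (div_le_div_of_nonneg_right (le_trans (le_max_left _ _) (le_max_right _ _)) (by positivity))
  -- the number of black arms is that of `κ`: one or two
  have hcount : ∑ j, (if κ (σ₀ j) = true then (1 : ℕ) else 0) = ∑ j, (if κ j = true then (1 : ℕ) else 0) :=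
    Equiv.sum_comp σ₀ (fun j => if κ j = true then (1 : ℕ) else 0)
  have h12' : (∑ j, (if κ (σ₀ j) = true then (1 : ℕ) else 0)) = 1 ∨ (∑ j, (if κ (σ₀ j) = true then (1 : ℕ) else 0)) = 2 := by
    rw [hcount]; rcases hκ with rfl | rfl <;> rw [Fin.sum_univ_five] <;> simp
  rw [Fin.sum_univ_five] at h12'
  -- case analysis on the sorted colour word
  rcases h0 : κ (σ₀ 0) <;> rcases h1 : κ (σ₀ 1) <;> rcases h2 : κ (σ₀ 2) <;> rcases h3 : κ (σ₀ 3) <;> rcases h4' : κ (σ₀ 4) <;>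
    simp only [h0, h1, h2, h3, h4'] at h12' <;> simp at h12' <;>
    first
      | (refine three 0 _ (Or.inl rfl) ?_; funext j; fin_cases j <;> simp [κE, h0, h1, h2, h3, h4'] <;> done)
      | (refine three 1 _ (Or.inl rfl) ?_; funext j; fin_cases j <;> simp [κE, h0, h1, h2, h3, h4'] <;> done)
      | (refine three 2 _ (Or.inl rfl) ?_; funext j; fin_cases j <;> simp [κE, h0, h1, h2, h3, h4'] <;> done)
      | (refine three 3 _ (Or.inl rfl) ?_; funext j; fin_cases j <;> simp [κE, h0, h1, h2, h3, h4'] <;> done)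
      | (refine three 4 _ (Or.inl rfl) ?_; funext j; fin_cases j <;> simp [κE, h0, h1, h2, h3, h4'] <;> done)
      | (refine three 0 _ (Or.inr (Or.inl rfl)) ?_; funext j; fin_cases j <;> simp [h0, h1, h2, h3, h4'] <;> done)
      | (refine three 1 _ (Or.inr (Or.inl rfl)) ?_; funext j; fin_cases j <;> simp [h0, h1, h2, h3, h4'] <;> done)
      | (refine three 2 _ (Or.inr (Or.inl rfl)) ?_; funext j; fin_cases j <;> simp [h0, h1, h2, h3, h4'] <;> done)
      | (refine three 3 _ (Or.inr (Or.inl rfl)) ?_; funext j; fin_cases j <;> simp [h0, h1, h2, h3, h4'] <;> done)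
      | (refine three 4 _ (Or.inr (Or.inl rfl)) ?_; funext j; fin_cases j <;> simp [h0, h1, h2, h3, h4'] <;> done)
      | (refine three 0 _ (Or.inr (Or.inr rfl)) ?_; funext j; fin_cases j <;> simp [h0, h1, h2, h3, h4'] <;> done)
      | (refine three 1 _ (Or.inr (Or.inr rfl)) ?_; funext j; fin_cases j <;> simp [h0, h1, h2, h3, h4'] <;> done)
      | (refine three 2 _ (Or.inr (Or.inr rfl)) ?_; funext j; fin_cases j <;> simp [h0, h1, h2, h3, h4'] <;> done)
      | (refine three 3 _ (Or.inr (Or.inr rfl)) ?_; funext j; fin_cases j <;> simp [h0, h1, h2, h3, h4'] <;> done)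
      | (refine three 4 _ (Or.inr (Or.inr rfl)) ?_; funext j; fin_cases j <;> simp [h0, h1, h2, h3, h4'])

/-! ### The two inputs of the normal form -/

/-- **From the tuples to the order-free event.** [cite: Nolin2008, §4.1 (arXiv 0711.4948, §4.1)] -/
theorem polyArmProb_le_of_tuples {κ : Fin 5 → Bool} {m n : ℕ} {C : ℝ} (hmn : m ≤ n)
    (hC : ∀ s : Fin 5 → Site 2, (∀ j, s j ∈ triSphere m) → (triSitePercolation half).real (plainArms κ s m n) ≤ C / (n : ℝ) ^ 2) :
    polyArmProb κ m n ≤ (triSphere m).card ^ 5 * C / (n : ℝ) ^ 2 := by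
  classical
  calc polyArmProb κ m n ≤ ∑ s ∈ landingTuples 5 m, (triSitePercolation half).real (plainArms κ s m n) :=
        polyArmProb_le_sum_plainArms κ hmn
    _ ≤ ∑ s ∈ landingTuples 5 m, C / (n : ℝ) ^ 2 :=
        Finset.sum_le_sum fun s hs => hC s fun j => Fintype.mem_piFinset.1 hs j
    _ = (triSphere m).card ^ 5 * C / (n : ℝ) ^ 2 := by
        rw [Finset.sum_const, nsmul_eq_mul, card_landingTuples]; push_cast; ring

/-- **The colour count `(1, 4)`**: `π_{(B,W,W,W,W)}(m, n) ≤ C(m)/n²` for `m ≥ 4`. [cite: Nolin2008, §5.2 Thm. 24, five-arm item (arXiv 0711.4948: Thm. 23 (iii))] -/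
theorem fiveArm_oneFour : ∃ m₀ : ℕ, ∀ m : ℕ, m₀ ≤ m → ∃ C : ℝ, ∀ n : ℕ, m ≤ n →
    polyArmProb ![true, false, false, false, false] m n ≤ C / (n : ℝ) ^ 2 := by
  refine ⟨4, fun m hm => ?_⟩
  obtain ⟨C, hC⟩ := exists_real_plainArms_le hm
  exact ⟨(triSphere m).card ^ 5 * C, fun n hmn => polyArmProb_le_of_tuples hmn fun s hs => hC n hmn _ (Or.inl rfl) s hs⟩

/-- **The colour count `(2, 3)`**: `π_{(B,W,B,W,W)}(m, n) ≤ C(m)/n²` for `m ≥ 4`. [cite: Nolin2008, §5.2 Thm. 24, five-arm item (arXiv 0711.4948: Thm. 23 (iii))] -/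
theorem fiveArm_twoThree : ∃ m₀ : ℕ, ∀ m : ℕ, m₀ ≤ m → ∃ C : ℝ, ∀ n : ℕ, m ≤ n →
    polyArmProb ![true, false, true, false, false] m n ≤ C / (n : ℝ) ^ 2 := by
  refine ⟨4, fun m hm => ?_⟩
  obtain ⟨C, hC⟩ := exists_real_plainArms_le hm
  exact ⟨(triSphere m).card ^ 5 * C, fun n hmn => polyArmProb_le_of_tuples hmn fun s hs => hC n hmn _ (Or.inr rfl) s hs⟩

/-- **Nolin 2008, Thm. 24, five-arm item (`α₅ ≤ 2`), discharged**: for every non-constant colour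
sequence `κ : Fin 5 → Bool` and every `m ≥ 1` there is `C` with `π_κ(m, n) ≤ C / n²` for all
`n ≥ m` — the universal five-arm upper bound on the triangular lattice at `p = 1/2`
(P. Nolin, *Near-critical percolation in two dimensions*, EJP 13 (2008), §5.2 Thm. 24, five-arm
item; arXiv 0711.4948 Thm. 23 (iii); after Kesten–Sidoravicius–Zhang 1998, Lemma 5, and
W. Werner, PCMI lectures (2009), first exercise sheet). The tree's proof: uniqueness of the black
arms after painting the inner core, at most six vertex-disjoint certified five-arm gadgets around the
sites of a box (the theta lemma `FiveArmKissingTheta` and the one-arm half bound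
`FiveArmKissingCount`), translation invariance (`FiveArmEUpper`), Nolin's inner colour switching
§5.1 Prop. 20 [arXiv Prop. 19] for the two other cyclic arrangements (`FiveArmInnerWalk`,
`FiveArmInnerFlip`, `real_plainArms_B4W_le`), the classification of the landing tuples
(`exists_real_plainArms_le`) and the reduction to two colour counts at large inner radii
(`FiveArmExponentUpperNormalForm`). [cite: Nolin2008, §5.2 Thm. 24, five-arm item (arXiv 0711.4948: Thm. 23 (iii))] -/
theorem Nolin2008_thm24_fiveArm_upper_holds : Nolin2008_thm24_fiveArm_upper :=
  Nolin2008_thm24_fiveArm_upper_of_two fiveArm_oneFour fiveArm_twoThree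

end Literature.Probability.Percolation

end
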